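import Literature.Combinatorics.Optimization.ShellLawLevelStep
import Literature.Combinatorics.Optimization.ShellLawSmoothing
import HarnessLib

/-!
# One TYPE step is a difference of two second x-differences: the edge-type companion of `levelStep_shellCount`

Setting of `Literature.Combinatorics.Optimization.ShellLawLevelStep` (`ShellStep` namespace): a fixed-point-free involution `π`
on `Fin n` (partner map of a perfect matching), a `π`-stable ground set `S`, a block `H`, the shells
`Shell_S(t,c) = {U ⊆ S : |U| = t, |half(U)| = c}` and the shell COUNT of the block statistic
`Sh_{S,H}(t,c;x) = #{U ∈ Shell_S(t,c) : |U ∩ H| = x}` (`shellCount`). [cite: Rothvoss2017, §2 (PDF pp. 5–6)]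

The level-step identity of that file compares two LEVELS of one block; its signed deletion sum `delStep` mixes two
edge TYPES of deleted sub-matchings (one `HH` + one `H̄H̄` edge deleted, versus two mixed edges deleted). This file
proves the identity that closes the bookkeeping: CHANGING THE TYPE OF ONE EDGE PAIR — turning an `HH` edge `{v, πv} ⊆ H`
and an `H̄H̄` edge `{w, πw}` (disjoint from `H`) into two mixed edges, i.e. passing from `H` to
`H′ = insert w (H.erase (π v))` — changes the shell count by a DIFFERENCE OF TWO SECOND x-DIFFERENCES of shell counts of the
doubly-deleted ground set `S″ = del2 π S v w` (on which `H` and `H′` agree):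

* §1 predicate-threaded one-edge patterns (the tree's `card_shellIn_avoid/half/full` with an arbitrary decidable
  predicate on the remaining cut carried through the bijection): `card_shellIn_avoid_filter`, `card_shellIn_half_filter`,
  `card_shellIn_full_filter`;
* §2 `shellCount_sub_shellCount_swap` — the indicator algebra: `Sh_H(x) − Sh_{H′}(x) = [A(x) − A(x+1)] + [B(x) − B(x−1)]`
  with `A(y) = #{U : πv ∈ U, w ∉ U, |U∩H| = y}`, `B(y) = #{U : πv ∉ U, w ∈ U, |U∩H| = y}` (since `|U∩H| − |U∩H′| = [πv ∈ U] − [w ∈ U]`);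
* §3 the eight two-edge pattern counts as shell counts on `S″` (`pattern_*`), and
* §4 **`typeStep_shellCount`**: for base level `c + 2` and cut size `t + 3`,
  `Sh_{S,H}(t+3,c+2;x) − Sh_{S,H′}(t+3,c+2;x) = ∇̃²Sh_{S″,H}(t+1,c+2;·)(x) − ∇̃²Sh_{S″,H}(t+1,c;·)(x)`,
  `∇̃²r(x) = r(x) − 2r(x−1) + r(x−2)`;
* §5 (v2) **`typeStep_shellCount_one`**: at base level `1` (the base level of the remainder chain) the second term is absent
  (no cut of level `1` has two half-chosen vertices; `patA_hh_one`, `patB_hh_one`);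
* §6 (v3) **`shellCount_eq_of_types_eq`** — TYPE INVARIANCE (transport): the shell count depends on `(S, H)` only through the
  type counts `(|vAA|, |vBH|, |vDD|)` (one-edge decomposition with the block count carried, induction on `|S|`); this is what turns
  `delStep`'s comparison of two differently deleted ground sets into the same-ground-set type step.

Probability form (divide by `|Shell_S|`; `s` full, `c` half, `u` untouched edges of `N′`):
`L(N′;a,b−2,d;s,c) − L(N′;a−1,b,d−1;s,c) = (su/(N′(N′−1)))·∇̃²L(N′−2;a−1,b−2,d−1;s−1,c) − (c(c−1)/(4N′(N′−1)))·∇̃²L(N′−2;a−1,b−2,d−1;s,c−2)`: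
only the statuses {one edge full, the other untouched} and {both half} of the swapped pair contribute. Combined with the
level step it exhibits the AD/BB discriminant cancellation: one level step = `(b(b−1) − 4ad)/(4N(N−1))·∇̃²` + `≈¼·∇̃⁴`
(cell pnp-psdrank eng MEMO-19 §2: found and checked in exact arithmetic on 21 000 cells before typing; with it the iterated
chain is within ×30 of the true `‖Δ^m_(2) law‖₁` at `(n, m) = (1296, 7)`, the type-blind TV chain ×2·10⁶ off). Mechanism: a
two-edge coupling — `U ↦ U ∖ {v, πv, w, πw}` sorted by the traces on the two edges. Elementary double counting, typed rather
than cited. [cite: Rothvoss2017, §2 (PDF pp. 5–6)] [cite: GodsilMeagher2015, §15.2]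
-/

noncomputable section

open Finset

namespace Literature.Combinatorics.Optimization

namespace ShellStep

variable {n : ℕ} {π : Fin n → Fin n}

/-! ### §1 One-edge patterns with a threaded predicate -/

/-- Cuts avoiding the edge at `v`, with any further condition `Q` on the cut:
`#{U ∈ Shell_S(t,c) : v, πv ∉ U, Q U} = #{W ∈ Shell_{S∖e}(t,c) : Q W}`. [cite: Rothvoss2017, §2 (PDF p. 6)] -/
theorem card_shellIn_avoid_filter {S : Finset (Fin n)} (v : Fin n) (t c : ℕ) (Q : Finset (Fin n) → Prop)
    [DecidablePred Q] :
    ((shellIn π S t c).filter fun U => v ∉ U ∧ π v ∉ U ∧ Q U).card =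
      ((shellIn π (S \ {v, π v}) t c).filter Q).card := by
  congr 1
  ext U
  simp only [mem_filter, mem_shellIn, subset_sdiff, disjoint_insert_right, disjoint_singleton_right]
  tauto

/-- Cuts through `v` but not `π v`, with any further condition `Q` on the rest of the cut:
`#{U ∈ Shell_S(t+1,c+1) : v ∈ U, πv ∉ U, Q (U.erase v)} = #{W ∈ Shell_{S∖e}(t,c) : Q W}` (`U = W ∪ {v}`).
[cite: Rothvoss2017, §2 (PDF p. 6)] -/
theorem card_shellIn_half_filter (hπ : ∀ v, π (π v) = v) (hπ' : ∀ v, π v ≠ v) {S : Finset (Fin n)} {v : Fin n}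
    (hv : v ∈ S) (t c : ℕ) (Q : Finset (Fin n) → Prop) [DecidablePred Q] :
    ((shellIn π S (t + 1) (c + 1)).filter fun U => v ∈ U ∧ π v ∉ U ∧ Q (U.erase v)).card =
      ((shellIn π (S \ {v, π v}) t c).filter Q).card := by
  have hvπ : v ≠ π v := (hπ' v).symm
  have hhalf : ∀ W : Finset (Fin n), v ∉ W → π v ∉ W →
      half π (insert v W) = insert v (half π W) := by
    intro W hvW hπvW
    ext u
    simp only [mem_half, mem_insert]
    constructor
    · rintro ⟨rfl | huW, hπu⟩
      · exact Or.inl rfl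
      · exact Or.inr ⟨huW, fun h => hπu (Or.inr h)⟩
    · rintro (rfl | ⟨huW, hπuW⟩)
      · exact ⟨Or.inl rfl, fun h => h.elim (fun e => hvπ e.symm) hπvW⟩
      · refine ⟨Or.inr huW, fun h => h.elim (fun e => ?_) hπuW⟩
        exact hπvW (((π_eq_iff hπ).1 e) ▸ huW)
  refine card_nbij' (fun U => U.erase v) (fun W => insert v W) ?_ ?_ ?_ ?_
  · intro U hU
    simp only [mem_coe, mem_filter, mem_shellIn] at hU ⊢
    obtain ⟨⟨hUS, hUt, hUc⟩, hvU, hπvU, hQ⟩ := hU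
    have hW : v ∉ U.erase v := fun h => (mem_erase.1 h).1 rfl
    have hπW : π v ∉ U.erase v := fun h => hπvU (mem_of_mem_erase h)
    have hUeq : U = insert v (U.erase v) := (insert_erase hvU).symm
    refine ⟨⟨?_, ?_, ?_⟩, hQ⟩
    · intro u hu
      rw [mem_sdiff, mem_insert, mem_singleton, not_or]
      obtain ⟨huv, huU⟩ := mem_erase.1 hu
      exact ⟨hUS huU, huv, fun e => hπvU (e ▸ huU)⟩
    · rw [card_erase_of_mem hvU, hUt]; rfl
    · have h := hhalf (U.erase v) hW hπW
      rw [← hUeq] at h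
      rw [h, card_insert_of_notMem (fun h' => hW (half_subset (π := π) _ h'))] at hUc
      omega
  · intro W hW
    simp only [mem_coe, mem_filter, mem_shellIn] at hW ⊢
    obtain ⟨⟨hWS, hWt, hWc⟩, hQ⟩ := hW
    have hvW : v ∉ W := fun h => by
      have := mem_sdiff.1 (hWS h); simp at this
    have hπvW : π v ∉ W := fun h => by
      have := mem_sdiff.1 (hWS h); simp at this
    refine ⟨⟨?_, ?_, ?_⟩, mem_insert_self _ _, ?_, ?_⟩
    · intro u hu
      rcases mem_insert.1 hu with rfl | huW
      · exact hv
      · exact (mem_sdiff.1 (hWS huW)).1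
    · rw [card_insert_of_notMem hvW, hWt]
    · rw [hhalf W hvW hπvW, card_insert_of_notMem (fun h' => hvW (half_subset (π := π) _ h')), hWc]
    · rw [mem_insert, not_or]; exact ⟨hvπ.symm, hπvW⟩
    · rwa [erase_insert hvW]
  · intro U hU
    simp only [mem_coe, mem_filter] at hU
    exact insert_erase hU.2.1
  · intro W hW
    simp only [mem_coe, mem_filter, mem_shellIn] at hW
    have hvW : v ∉ W := fun h => by
      have := mem_sdiff.1 (hW.1.1 h); simp at this
    exact erase_insert hvW

/-- Cuts containing the edge at `v`, with any further condition `Q` on the rest of the cut: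
`#{U ∈ Shell_S(t+2,c) : v, πv ∈ U, Q (U ∖ e)} = #{W ∈ Shell_{S∖e}(t,c) : Q W}` (`U = W ∪ e`).
[cite: Rothvoss2017, §2 (PDF p. 6)] -/
theorem card_shellIn_full_filter (hπ : ∀ v, π (π v) = v) (hπ' : ∀ v, π v ≠ v) {S : Finset (Fin n)}
    (hS : ∀ v ∈ S, π v ∈ S) {v : Fin n} (hv : v ∈ S) (t c : ℕ) (Q : Finset (Fin n) → Prop) [DecidablePred Q] :
    ((shellIn π S (t + 2) c).filter fun U => v ∈ U ∧ π v ∈ U ∧ Q (U \ {v, π v})).card =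
      ((shellIn π (S \ {v, π v}) t c).filter Q).card := by
  have hPcard : ({v, π v} : Finset (Fin n)).card = 2 := card_pair (hπ' v).symm
  have hPsub : ∀ {U : Finset (Fin n)}, v ∈ U → π v ∈ U → ({v, π v} : Finset (Fin n)) ⊆ U :=
    fun hvU hπvU u hu => by
      rcases mem_insert.1 hu with rfl | h
      · exact hvU
      · rw [mem_singleton] at h; subst h; exact hπvU
  have hdisjW : ∀ {W : Finset (Fin n)}, v ∉ W → π v ∉ W → Disjoint W {v, π v} :=
    fun hvW hπvW => disjoint_left.2 fun u huW huP => by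
      rcases mem_insert.1 huP with rfl | h
      · exact hvW huW
      · rw [mem_singleton] at h; subst h; exact hπvW huW
  refine card_nbij' (fun U => U \ {v, π v}) (fun W => W ∪ {v, π v}) ?_ ?_ ?_ ?_
  · intro U hU
    simp only [mem_coe, mem_filter, mem_shellIn] at hU ⊢
    obtain ⟨⟨hUS, hUt, hUc⟩, hvU, hπvU, hQ⟩ := hU
    refine ⟨⟨sdiff_subset_sdiff hUS le_rfl, ?_, ?_⟩, hQ⟩
    · rw [card_sdiff_of_subset (hPsub hvU hπvU), hUt, hPcard]; omega
    · rw [half_sdiff_pair hπ hvU hπvU, hUc]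
  · intro W hW
    simp only [mem_coe, mem_filter, mem_shellIn] at hW ⊢
    obtain ⟨⟨hWS, hWt, hWc⟩, hQ⟩ := hW
    have hvW : v ∉ W := fun h => by
      have := mem_sdiff.1 (hWS h); simp at this
    have hπvW : π v ∉ W := fun h => by
      have := mem_sdiff.1 (hWS h); simp at this
    have hdisj := hdisjW hvW hπvW
    have hvU : v ∈ W ∪ {v, π v} := mem_union_right _ (mem_insert_self _ _)
    have hπvU : π v ∈ W ∪ {v, π v} := mem_union_right _ (mem_insert_of_mem (mem_singleton_self _))
    have e : (W ∪ {v, π v}) \ {v, π v} = W := by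
      rw [union_sdiff_right, sdiff_eq_self_of_disjoint hdisj]
    refine ⟨⟨?_, ?_, ?_⟩, hvU, hπvU, ?_⟩
    · intro u hu
      rcases mem_union.1 hu with h | h
      · exact (mem_sdiff.1 (hWS h)).1
      · rcases mem_insert.1 h with rfl | h
        · exact hv
        · rw [mem_singleton] at h; subst h; exact hS _ hv
    · rw [card_union_of_disjoint hdisj, hWt, hPcard]
    · rw [← half_sdiff_pair hπ hvU hπvU, e, hWc]
    · rwa [e]
  · intro U hU
    simp only [mem_coe, mem_filter] at hU
    exact sdiff_union_of_subset (hPsub hU.2.1 hU.2.2.1)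
  · intro W hW
    simp only [mem_coe, mem_filter, mem_shellIn] at hW
    have hvW : v ∉ W := fun h => by
      have := mem_sdiff.1 (hW.1.1 h); simp at this
    have hπvW : π v ∉ W := fun h => by
      have := mem_sdiff.1 (hW.1.1 h); simp at this
    show (W ∪ {v, π v}) \ {v, π v} = W
    rw [union_sdiff_right, sdiff_eq_self_of_disjoint (hdisjW hvW hπvW)]

/-! ### §2 The indicator algebra of a type swap -/

/-- Pointwise bookkeeping of the swap: with `k = |U ∩ H|`, `P = (p ∈ U)`, `Q = (q ∈ U)` and `|U ∩ H′| = k − [P] + [Q]`,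
`[k = x] − [k − [P] + [Q] = x] = ([P ∧ ¬Q ∧ k = x] − [P ∧ ¬Q ∧ k = x+1]) + ([¬P ∧ Q ∧ k = x] − [¬P ∧ Q ∧ k = x−1])`. [folklore] -/
private theorem indicator_swap (k x : ℤ) (P Q : Prop) [Decidable P] [Decidable Q] :
    ((if k = x then (1 : ℝ) else 0) - (if k - (if P then 1 else 0) + (if Q then 1 else 0) = x then 1 else 0)) =
      ((if P ∧ ¬Q ∧ k = x then (1 : ℝ) else 0) - (if P ∧ ¬Q ∧ k = x + 1 then 1 else 0)) +
        ((if ¬P ∧ Q ∧ k = x then (1 : ℝ) else 0) - (if ¬P ∧ Q ∧ k = x - 1 then 1 else 0)) := by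
  by_cases hP : P <;> by_cases hQ : Q <;> simp only [hP, hQ, if_true, if_false, not_true_eq_false, not_false_eq_true,
    true_and, false_and, sub_zero, add_zero, zero_add, sub_self] <;> split_ifs <;> norm_num <;> omega

/-- **The swap as two pinned differences.** For `p ∈ H`, `q ∉ H` and `H′ = insert q (H.erase p)`:
`Sh_{S,H}(T,c;x) − Sh_{S,H′}(T,c;x) = [A(x) − A(x+1)] + [B(x) − B(x−1)]` with
`A(y) = #{U ∈ Shell_S(T,c) : p ∈ U, q ∉ U, |U∩H| = y}`, `B(y) = #{U ∈ Shell_S(T,c) : p ∉ U, q ∈ U, |U∩H| = y}`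
(because `|U ∩ H′| = |U ∩ H| − [p ∈ U] + [q ∈ U]`). [cite: Rothvoss2017, §2 (PDF p. 6)] -/
theorem shellCount_sub_shellCount_swap {S H : Finset (Fin n)} {p q : Fin n} (hpH : p ∈ H) (hqH : q ∉ H)
    (T c : ℕ) (x : ℤ) :
    shellCount π S H T c x - shellCount π S (insert q (H.erase p)) T c x =
      ((((shellIn π S T c).filter fun U => p ∈ U ∧ q ∉ U ∧ ((U ∩ H).card : ℤ) = x).card : ℝ) -
        (((shellIn π S T c).filter fun U => p ∈ U ∧ q ∉ U ∧ ((U ∩ H).card : ℤ) = x + 1).card : ℝ)) +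
      ((((shellIn π S T c).filter fun U => p ∉ U ∧ q ∈ U ∧ ((U ∩ H).card : ℤ) = x).card : ℝ) -
        (((shellIn π S T c).filter fun U => p ∉ U ∧ q ∈ U ∧ ((U ∩ H).card : ℤ) = x - 1).card : ℝ)) := by
  -- `|U ∩ H′| = |U ∩ H| − [p ∈ U] + [q ∈ U]`
  have hcount : ∀ U : Finset (Fin n), ((U ∩ insert q (H.erase p)).card : ℤ) =
      ((U ∩ H).card : ℤ) - (if p ∈ U then 1 else 0) + (if q ∈ U then 1 else 0) := by
    intro U
    have hq' : q ∉ U ∩ H.erase p := fun h => hqH (mem_of_mem_erase (mem_inter.1 h).2)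
    have hA : U ∩ insert q (H.erase p) = (if q ∈ U then insert q (U ∩ H.erase p) else U ∩ H.erase p) := by
      ext u
      by_cases hqU : q ∈ U
      · simp only [hqU, if_true, mem_inter, mem_insert, mem_erase]
        constructor
        · rintro ⟨huU, rfl | ⟨hup, huH⟩⟩
          · exact Or.inl rfl
          · exact Or.inr ⟨huU, hup, huH⟩
        · rintro (rfl | ⟨huU, hup, huH⟩)
          · exact ⟨hqU, Or.inl rfl⟩
          · exact ⟨huU, Or.inr ⟨hup, huH⟩⟩
      · simp only [hqU, if_false, mem_inter, mem_insert, mem_erase]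
        constructor
        · rintro ⟨huU, rfl | ⟨hup, huH⟩⟩
          · exact absurd huU hqU
          · exact ⟨huU, hup, huH⟩
        · rintro ⟨huU, hup, huH⟩; exact ⟨huU, Or.inr ⟨hup, huH⟩⟩
    have hB : ((U ∩ H.erase p).card : ℤ) = ((U ∩ H).card : ℤ) - (if p ∈ U then 1 else 0) := by
      by_cases hpU : p ∈ U
      · have e3 : U ∩ H.erase p = (U ∩ H).erase p := by
          ext u; simp only [mem_inter, mem_erase]; tauto
        have h1 : 1 ≤ (U ∩ H).card := card_pos.2 ⟨p, mem_inter.2 ⟨hpU, hpH⟩⟩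
        rw [e3, card_erase_of_mem (mem_inter.2 ⟨hpU, hpH⟩), if_pos hpU, Nat.cast_sub h1]; push_cast; ring
      · have e3 : U ∩ H.erase p = U ∩ H := by
          ext u; simp only [mem_inter, mem_erase]
          constructor
          · rintro ⟨huU, _, huH⟩; exact ⟨huU, huH⟩
          · rintro ⟨huU, huH⟩; exact ⟨huU, fun e => hpU (e ▸ huU), huH⟩
        rw [e3, if_neg hpU]; ring
    by_cases hqU : q ∈ U
    · rw [hA, if_pos hqU, card_insert_of_notMem hq', if_pos hqU]; push_cast; rw [hB]
    · rw [hA, if_neg hqU, if_neg hqU, hB]; ring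
  -- sums of indicators, compared pointwise
  rw [shellCount_eq_sum, shellCount_eq_sum]
  simp only [card_filter]
  push_cast
  rw [← sum_sub_distrib, ← sum_sub_distrib, ← sum_sub_distrib, ← sum_add_distrib]
  refine sum_congr rfl fun U _ => ?_
  rw [hcount U]
  exact indicator_swap _ x (p ∈ U) (q ∈ U)


/-! ### §3 Two-edge patterns: the eight pinned counts of a type swap as shell counts of `S″ = del2 π S v w` -/

/-- `u ∈ U ∖ {a, b} ↔ u ∈ U` for `u ≠ a, b`. [folklore] -/
private theorem mem_sdiff_pair_iff {U : Finset (Fin n)} {u a b : Fin n} (ha : u ≠ a) (hb : u ≠ b) :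
    u ∈ U \ {a, b} ↔ u ∈ U := by
  rw [mem_sdiff, mem_insert, mem_singleton, not_or]
  exact ⟨fun h => h.1, fun h => ⟨h, ha, hb⟩⟩

/-- `u ∈ U.erase z ↔ u ∈ U` for `u ≠ z`. [folklore] -/
private theorem mem_erase_iff_of_ne {U : Finset (Fin n)} {u z : Fin n} (h : u ≠ z) : u ∈ U.erase z ↔ u ∈ U :=
  ⟨fun h' => (mem_erase.1 h').2, fun h' => mem_erase.2 ⟨h, h'⟩⟩

/-- `S ∖ {π u, π (π u)} = S ∖ {u, π u}`. [cite: GodsilMeagher2015, §15.2] -/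
theorem sdiff_pair_partner (hπ : ∀ v, π (π v) = v) (S : Finset (Fin n)) (u : Fin n) :
    S \ {π u, π (π u)} = S \ {u, π u} := by
  rw [hπ, pair_comm]

/-- Deleting the two edges one after the other is `del2`. [cite: GodsilMeagher2015, §15.2] -/
theorem sdiff_sdiff_eq_del2 (S : Finset (Fin n)) (v w : Fin n) : (S \ {v, π v}) \ {w, π w} = del2 π S v w := by
  ext u; simp only [mem_sdiff, mem_del2, mem_insert, mem_singleton, not_or]; tauto

/-- Deleting the two edges in the other order is `del2` as well. [cite: GodsilMeagher2015, §15.2] -/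
theorem sdiff_sdiff_eq_del2' (S : Finset (Fin n)) (v w : Fin n) : (S \ {w, π w}) \ {v, π v} = del2 π S v w := by
  ext u; simp only [mem_sdiff, mem_del2, mem_insert, mem_singleton, not_or]; tauto

/-- Removing a full edge inside `H` lowers the block count by `2`. [cite: Rothvoss2017, §2 (PDF p. 5)] -/
theorem card_inter_sdiff_pair_of_mem (hπ' : ∀ v, π v ≠ v) {H U : Finset (Fin n)} {v : Fin n} (hvH : v ∈ H)
    (hπvH : π v ∈ H) (hvU : v ∈ U) (hπvU : π v ∈ U) :
    ((((U \ {v, π v}) ∩ H).card : ℕ) : ℤ) = ((U ∩ H).card : ℤ) - 2 := by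
  rw [card_inter_sdiff_pair hvU hπvU H]
  have : ({v, π v} ∩ H : Finset (Fin n)) = {v, π v} := by
    ext u; simp only [mem_inter, mem_insert, mem_singleton]
    constructor
    · exact fun h => h.1
    · rintro (rfl | rfl)
      exacts [⟨Or.inl rfl, hvH⟩, ⟨Or.inr rfl, hπvH⟩]
  rw [this, card_pair (hπ' v).symm]; rfl

/-- Removing an edge outside `H` keeps the block count. [cite: Rothvoss2017, §2 (PDF p. 5)] -/
theorem inter_sdiff_pair_of_not_mem {H : Finset (Fin n)} {w : Fin n} (hwH : w ∉ H) (hπwH : π w ∉ H)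
    (U : Finset (Fin n)) : (U \ {w, π w}) ∩ H = U ∩ H := by
  ext u; simp only [mem_inter, mem_sdiff, mem_insert, mem_singleton, not_or]
  constructor
  · rintro ⟨⟨huU, _⟩, huH⟩; exact ⟨huU, huH⟩
  · rintro ⟨huU, huH⟩; exact ⟨⟨huU, fun e => hwH (e ▸ huH), fun e => hπwH (e ▸ huH)⟩, huH⟩

/-- Erasing an `H`-vertex of the cut lowers the block count by `1`. [cite: Rothvoss2017, §2 (PDF p. 5)] -/
theorem card_inter_erase_of_mem {H U : Finset (Fin n)} {u : Fin n} (huH : u ∈ H) (huU : u ∈ U) :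
    ((((U.erase u) ∩ H).card : ℕ) : ℤ) = ((U ∩ H).card : ℤ) - 1 := by
  have e : (U.erase u) ∩ H = (U ∩ H).erase u := by
    ext z; simp only [mem_inter, mem_erase]; tauto
  have h1 : 1 ≤ (U ∩ H).card := card_pos.2 ⟨u, mem_inter.2 ⟨huU, huH⟩⟩
  rw [e, card_erase_of_mem (mem_inter.2 ⟨huU, huH⟩), Nat.cast_sub h1]; rfl

/-- Erasing a non-`H` vertex keeps the block count. [cite: Rothvoss2017, §2 (PDF p. 5)] -/
theorem inter_erase_of_not_mem {H : Finset (Fin n)} {u : Fin n} (hu : u ∉ H) (U : Finset (Fin n)) :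
    (U.erase u) ∩ H = U ∩ H := by
  ext z; simp only [mem_inter, mem_erase]
  constructor
  · rintro ⟨⟨_, hzU⟩, hzH⟩; exact ⟨hzU, hzH⟩
  · rintro ⟨hzU, hzH⟩; exact ⟨⟨fun e => hu (e ▸ hzH), hzU⟩, hzH⟩

section Patterns

variable (hπ : ∀ v, π (π v) = v) (hπ' : ∀ v, π v ≠ v) {S H : Finset (Fin n)} (hS : ∀ u ∈ S, π u ∈ S)
  {v w : Fin n} (hv : v ∈ S) (hw : w ∈ S) (hvH : v ∈ H) (hπvH : π v ∈ H) (hwH : w ∉ H) (hπwH : π w ∉ H)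
include hπ hπ' hS hv hw hvH hπvH hwH hπwH

omit hw in
/-- Pattern A-(full, avoid): `e₁` full, `e₂` untouched. [cite: Rothvoss2017, §2 (PDF p. 6)] -/
theorem patA_fa (t c : ℕ) (y : ℤ) :
    ((shellIn π S (t + 3) (c + 2)).filter fun U =>
        π v ∈ U ∧ w ∉ U ∧ ((U ∩ H).card : ℤ) = y ∧ v ∈ U ∧ π w ∉ U).card =
      ((shellIn π (del2 π S v w) (t + 1) (c + 2)).filter fun W => ((W ∩ H).card : ℤ) = y - 2).card := by
  have hwv : w ≠ v := fun e => hwH (e ▸ hvH)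
  have hwπv : w ≠ π v := fun e => hwH (e ▸ hπvH)
  have hπwv : π w ≠ v := fun e => hπwH (e ▸ hvH)
  have hπwπv : π w ≠ π v := fun e => hπwH (e ▸ hπvH)
  have e : ((shellIn π S (t + 3) (c + 2)).filter fun U =>
        π v ∈ U ∧ w ∉ U ∧ ((U ∩ H).card : ℤ) = y ∧ v ∈ U ∧ π w ∉ U) =
      ((shellIn π S ((t + 1) + 2) (c + 2)).filter fun U => v ∈ U ∧ π v ∈ U ∧
        (w ∉ U \ {v, π v} ∧ π w ∉ U \ {v, π v} ∧ ((((U \ {v, π v}) ∩ H).card : ℕ) : ℤ) = y - 2)) := by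
    refine filter_congr fun U _ => ?_
    constructor
    · rintro ⟨hπvU, hwU, hy, hvU, hπwU⟩
      refine ⟨hvU, hπvU, (mem_sdiff_pair_iff hwv hwπv).not.2 hwU, (mem_sdiff_pair_iff hπwv hπwπv).not.2 hπwU, ?_⟩
      rw [card_inter_sdiff_pair_of_mem hπ' hvH hπvH hvU hπvU, hy]
    · rintro ⟨hvU, hπvU, hwU, hπwU, hy⟩
      refine ⟨hπvU, (mem_sdiff_pair_iff hwv hwπv).not.1 hwU, ?_, hvU, (mem_sdiff_pair_iff hπwv hπwπv).not.1 hπwU⟩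
      rw [card_inter_sdiff_pair_of_mem hπ' hvH hπvH hvU hπvU] at hy; omega
  rw [e, card_shellIn_full_filter hπ hπ' hS hv (t + 1) (c + 2)
    (fun W => w ∉ W ∧ π w ∉ W ∧ (((W ∩ H).card : ℕ) : ℤ) = y - 2),
    card_shellIn_avoid_filter w (t + 1) (c + 2) (fun W => (((W ∩ H).card : ℕ) : ℤ) = y - 2), sdiff_sdiff_eq_del2]

/-- Pattern A-(full, half): `e₁` full, `π w` half-chosen. [cite: Rothvoss2017, §2 (PDF p. 6)] -/
theorem patA_fh (t c : ℕ) (y : ℤ) :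
    ((shellIn π S (t + 3) (c + 2)).filter fun U =>
        π v ∈ U ∧ w ∉ U ∧ ((U ∩ H).card : ℤ) = y ∧ v ∈ U ∧ π w ∈ U).card =
      ((shellIn π (del2 π S v w) t (c + 1)).filter fun W => ((W ∩ H).card : ℤ) = y - 2).card := by
  have hwv : w ≠ v := fun e => hwH (e ▸ hvH)
  have hwπv : w ≠ π v := fun e => hwH (e ▸ hπvH)
  have hπwv : π w ≠ v := fun e => hπwH (e ▸ hvH)
  have hπwπv : π w ≠ π v := fun e => hπwH (e ▸ hπvH)
  have hπw : π w ∈ S \ {v, π v} := (mem_sdiff_pair_iff hπwv hπwπv).2 (hS w hw)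
  have e : ((shellIn π S (t + 3) (c + 2)).filter fun U =>
        π v ∈ U ∧ w ∉ U ∧ ((U ∩ H).card : ℤ) = y ∧ v ∈ U ∧ π w ∈ U) =
      ((shellIn π S ((t + 1) + 2) (c + 2)).filter fun U => v ∈ U ∧ π v ∈ U ∧
        (π w ∈ U \ {v, π v} ∧ π (π w) ∉ U \ {v, π v} ∧
          (((((U \ {v, π v}).erase (π w)) ∩ H).card : ℕ) : ℤ) = y - 2)) := by
    refine filter_congr fun U _ => ?_
    rw [hπ w]
    constructor
    · rintro ⟨hπvU, hwU, hy, hvU, hπwU⟩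
      refine ⟨hvU, hπvU, (mem_sdiff_pair_iff hπwv hπwπv).2 hπwU, (mem_sdiff_pair_iff hwv hwπv).not.2 hwU, ?_⟩
      rw [inter_erase_of_not_mem hπwH, card_inter_sdiff_pair_of_mem hπ' hvH hπvH hvU hπvU, hy]
    · rintro ⟨hvU, hπvU, hπwU, hwU, hy⟩
      refine ⟨hπvU, (mem_sdiff_pair_iff hwv hwπv).not.1 hwU, ?_, hvU, (mem_sdiff_pair_iff hπwv hπwπv).1 hπwU⟩
      rw [inter_erase_of_not_mem hπwH, card_inter_sdiff_pair_of_mem hπ' hvH hπvH hvU hπvU] at hy; omega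
  rw [e, card_shellIn_full_filter hπ hπ' hS hv (t + 1) (c + 2)
    (fun W => π w ∈ W ∧ π (π w) ∉ W ∧ ((((W.erase (π w)) ∩ H).card : ℕ) : ℤ) = y - 2),
    card_shellIn_half_filter hπ hπ' hπw t (c + 1) (fun W => (((W ∩ H).card : ℕ) : ℤ) = y - 2),
    sdiff_pair_partner hπ, sdiff_sdiff_eq_del2]

/-- Pattern A-(half, half): `π v` and `π w` half-chosen. [cite: Rothvoss2017, §2 (PDF p. 6)] -/
theorem patA_hh (t c : ℕ) (y : ℤ) :
    ((shellIn π S (t + 3) (c + 2)).filter fun U =>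
        π v ∈ U ∧ w ∉ U ∧ ((U ∩ H).card : ℤ) = y ∧ v ∉ U ∧ π w ∈ U).card =
      ((shellIn π (del2 π S v w) (t + 1) c).filter fun W => ((W ∩ H).card : ℤ) = y - 1).card := by
  have hwπv : w ≠ π v := fun e => hwH (e ▸ hπvH)
  have hπwv : π w ≠ v := fun e => hπwH (e ▸ hvH)
  have hπwπv : π w ≠ π v := fun e => hπwH (e ▸ hπvH)
  have hπv : π v ∈ S := hS v hv
  have hπw : π w ∈ S \ {v, π v} := (mem_sdiff_pair_iff hπwv hπwπv).2 (hS w hw)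
  have e : ((shellIn π S (t + 3) (c + 2)).filter fun U =>
        π v ∈ U ∧ w ∉ U ∧ ((U ∩ H).card : ℤ) = y ∧ v ∉ U ∧ π w ∈ U) =
      ((shellIn π S ((t + 2) + 1) ((c + 1) + 1)).filter fun U => π v ∈ U ∧ π (π v) ∉ U ∧
        (π w ∈ U.erase (π v) ∧ π (π w) ∉ U.erase (π v) ∧
          (((((U.erase (π v)).erase (π w)) ∩ H).card : ℕ) : ℤ) = y - 1)) := by
    refine filter_congr fun U _ => ?_
    rw [hπ v, hπ w]
    constructor
    · rintro ⟨hπvU, hwU, hy, hvU, hπwU⟩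
      refine ⟨hπvU, hvU, (mem_erase_iff_of_ne hπwπv).2 hπwU, (mem_erase_iff_of_ne hwπv).not.2 hwU, ?_⟩
      rw [inter_erase_of_not_mem hπwH, card_inter_erase_of_mem hπvH hπvU, hy]
    · rintro ⟨hπvU, hvU, hπwU, hwU, hy⟩
      refine ⟨hπvU, (mem_erase_iff_of_ne hwπv).not.1 hwU, ?_, hvU, (mem_erase_iff_of_ne hπwπv).1 hπwU⟩
      rw [inter_erase_of_not_mem hπwH, card_inter_erase_of_mem hπvH hπvU] at hy; omega
  rw [e, card_shellIn_half_filter hπ hπ' hπv (t + 2) (c + 1)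
    (fun W => π w ∈ W ∧ π (π w) ∉ W ∧ ((((W.erase (π w)) ∩ H).card : ℕ) : ℤ) = y - 1),
    sdiff_pair_partner hπ,
    card_shellIn_half_filter hπ hπ' hπw (t + 1) c (fun W => (((W ∩ H).card : ℕ) : ℤ) = y - 1),
    sdiff_pair_partner hπ, sdiff_sdiff_eq_del2]

omit hw hvH in
/-- Pattern A-(half, avoid): `π v` half-chosen, `e₂` untouched. [cite: Rothvoss2017, §2 (PDF p. 6)] -/
theorem patA_ha (t c : ℕ) (y : ℤ) :
    ((shellIn π S (t + 3) (c + 2)).filter fun U =>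
        π v ∈ U ∧ w ∉ U ∧ ((U ∩ H).card : ℤ) = y ∧ v ∉ U ∧ π w ∉ U).card =
      ((shellIn π (del2 π S v w) (t + 2) (c + 1)).filter fun W => ((W ∩ H).card : ℤ) = y - 1).card := by
  have hwπv : w ≠ π v := fun e => hwH (e ▸ hπvH)
  have hπwπv : π w ≠ π v := fun e => hπwH (e ▸ hπvH)
  have hπv : π v ∈ S := hS v hv
  have e : ((shellIn π S (t + 3) (c + 2)).filter fun U =>
        π v ∈ U ∧ w ∉ U ∧ ((U ∩ H).card : ℤ) = y ∧ v ∉ U ∧ π w ∉ U) =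
      ((shellIn π S ((t + 2) + 1) ((c + 1) + 1)).filter fun U => π v ∈ U ∧ π (π v) ∉ U ∧
        (w ∉ U.erase (π v) ∧ π w ∉ U.erase (π v) ∧ ((((U.erase (π v)) ∩ H).card : ℕ) : ℤ) = y - 1)) := by
    refine filter_congr fun U _ => ?_
    rw [hπ v]
    constructor
    · rintro ⟨hπvU, hwU, hy, hvU, hπwU⟩
      refine ⟨hπvU, hvU, (mem_erase_iff_of_ne hwπv).not.2 hwU, (mem_erase_iff_of_ne hπwπv).not.2 hπwU, ?_⟩
      rw [card_inter_erase_of_mem hπvH hπvU, hy]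
    · rintro ⟨hπvU, hvU, hwU, hπwU, hy⟩
      refine ⟨hπvU, (mem_erase_iff_of_ne hwπv).not.1 hwU, ?_, hvU, (mem_erase_iff_of_ne hπwπv).not.1 hπwU⟩
      rw [card_inter_erase_of_mem hπvH hπvU] at hy; omega
  rw [e, card_shellIn_half_filter hπ hπ' hπv (t + 2) (c + 1)
    (fun W => w ∉ W ∧ π w ∉ W ∧ (((W ∩ H).card : ℕ) : ℤ) = y - 1),
    sdiff_pair_partner hπ,
    card_shellIn_avoid_filter w (t + 2) (c + 1) (fun W => (((W ∩ H).card : ℕ) : ℤ) = y - 1), sdiff_sdiff_eq_del2]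

/-- Pattern B-(half, full): `v` half-chosen, `e₂` full. [cite: Rothvoss2017, §2 (PDF p. 6)] -/
theorem patB_hf (t c : ℕ) (y : ℤ) :
    ((shellIn π S (t + 3) (c + 2)).filter fun U =>
        π v ∉ U ∧ w ∈ U ∧ ((U ∩ H).card : ℤ) = y ∧ v ∈ U ∧ π w ∈ U).card =
      ((shellIn π (del2 π S v w) t (c + 1)).filter fun W => ((W ∩ H).card : ℤ) = y - 1).card := by
  have hvw : v ≠ w := fun e => hwH (e ▸ hvH)
  have hvπw : v ≠ π w := fun e => hπwH (e ▸ hvH)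
  have hπvw : π v ≠ w := fun e => hwH (e ▸ hπvH)
  have hπvπw : π v ≠ π w := fun e => hπwH (e ▸ hπvH)
  have hv' : v ∈ S \ {w, π w} := (mem_sdiff_pair_iff hvw hvπw).2 hv
  have e : ((shellIn π S (t + 3) (c + 2)).filter fun U =>
        π v ∉ U ∧ w ∈ U ∧ ((U ∩ H).card : ℤ) = y ∧ v ∈ U ∧ π w ∈ U) =
      ((shellIn π S ((t + 1) + 2) (c + 2)).filter fun U => w ∈ U ∧ π w ∈ U ∧
        (v ∈ U \ {w, π w} ∧ π v ∉ U \ {w, π w} ∧ (((((U \ {w, π w}).erase v) ∩ H).card : ℕ) : ℤ) = y - 1)) := by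
    refine filter_congr fun U _ => ?_
    constructor
    · rintro ⟨hπvU, hwU, hy, hvU, hπwU⟩
      refine ⟨hwU, hπwU, (mem_sdiff_pair_iff hvw hvπw).2 hvU, (mem_sdiff_pair_iff hπvw hπvπw).not.2 hπvU, ?_⟩
      rw [card_inter_erase_of_mem hvH ((mem_sdiff_pair_iff hvw hvπw).2 hvU), inter_sdiff_pair_of_not_mem hwH hπwH, hy]
    · rintro ⟨hwU, hπwU, hvU, hπvU, hy⟩
      have hvU' : v ∈ U := (mem_sdiff_pair_iff hvw hvπw).1 hvU
      refine ⟨(mem_sdiff_pair_iff hπvw hπvπw).not.1 hπvU, hwU, ?_, hvU', hπwU⟩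
      rw [card_inter_erase_of_mem hvH hvU, inter_sdiff_pair_of_not_mem hwH hπwH] at hy; omega
  rw [e, card_shellIn_full_filter hπ hπ' hS hw (t + 1) (c + 2)
    (fun W => v ∈ W ∧ π v ∉ W ∧ ((((W.erase v) ∩ H).card : ℕ) : ℤ) = y - 1),
    card_shellIn_half_filter hπ hπ' hv' t (c + 1) (fun W => (((W ∩ H).card : ℕ) : ℤ) = y - 1),
    sdiff_sdiff_eq_del2']

omit hS in
/-- Pattern B-(half, half): `v` and `w` half-chosen. [cite: Rothvoss2017, §2 (PDF p. 6)] -/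
theorem patB_hh (t c : ℕ) (y : ℤ) :
    ((shellIn π S (t + 3) (c + 2)).filter fun U =>
        π v ∉ U ∧ w ∈ U ∧ ((U ∩ H).card : ℤ) = y ∧ v ∈ U ∧ π w ∉ U).card =
      ((shellIn π (del2 π S v w) (t + 1) c).filter fun W => ((W ∩ H).card : ℤ) = y - 1).card := by
  have hwv : w ≠ v := fun e => hwH (e ▸ hvH)
  have hπvw : π v ≠ w := fun e => hwH (e ▸ hπvH)
  have hπwv : π w ≠ v := fun e => hπwH (e ▸ hvH)
  have hw' : w ∈ S \ {v, π v} := (mem_sdiff_pair_iff hwv (fun e => hwH (e ▸ hπvH))).2 hw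
  have e : ((shellIn π S (t + 3) (c + 2)).filter fun U =>
        π v ∉ U ∧ w ∈ U ∧ ((U ∩ H).card : ℤ) = y ∧ v ∈ U ∧ π w ∉ U) =
      ((shellIn π S ((t + 2) + 1) ((c + 1) + 1)).filter fun U => v ∈ U ∧ π v ∉ U ∧
        (w ∈ U.erase v ∧ π w ∉ U.erase v ∧ (((((U.erase v).erase w) ∩ H).card : ℕ) : ℤ) = y - 1)) := by
    refine filter_congr fun U _ => ?_
    constructor
    · rintro ⟨hπvU, hwU, hy, hvU, hπwU⟩
      refine ⟨hvU, hπvU, (mem_erase_iff_of_ne hwv).2 hwU, (mem_erase_iff_of_ne hπwv).not.2 hπwU, ?_⟩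
      rw [inter_erase_of_not_mem hwH, card_inter_erase_of_mem hvH hvU, hy]
    · rintro ⟨hvU, hπvU, hwU, hπwU, hy⟩
      refine ⟨hπvU, (mem_erase_iff_of_ne hwv).1 hwU, ?_, hvU, (mem_erase_iff_of_ne hπwv).not.1 hπwU⟩
      rw [inter_erase_of_not_mem hwH, card_inter_erase_of_mem hvH hvU] at hy; omega
  rw [e, card_shellIn_half_filter hπ hπ' hv (t + 2) (c + 1)
    (fun W => w ∈ W ∧ π w ∉ W ∧ ((((W.erase w) ∩ H).card : ℕ) : ℤ) = y - 1),
    card_shellIn_half_filter hπ hπ' hw' (t + 1) c (fun W => (((W ∩ H).card : ℕ) : ℤ) = y - 1),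
    sdiff_sdiff_eq_del2]

omit hv in
/-- Pattern B-(avoid, full): `e₁` untouched, `e₂` full. [cite: Rothvoss2017, §2 (PDF p. 6)] -/
theorem patB_af (t c : ℕ) (y : ℤ) :
    ((shellIn π S (t + 3) (c + 2)).filter fun U =>
        π v ∉ U ∧ w ∈ U ∧ ((U ∩ H).card : ℤ) = y ∧ v ∉ U ∧ π w ∈ U).card =
      ((shellIn π (del2 π S v w) (t + 1) (c + 2)).filter fun W => ((W ∩ H).card : ℤ) = y).card := by
  have hvw : v ≠ w := fun e => hwH (e ▸ hvH)
  have hvπw : v ≠ π w := fun e => hπwH (e ▸ hvH)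
  have hπvw : π v ≠ w := fun e => hwH (e ▸ hπvH)
  have hπvπw : π v ≠ π w := fun e => hπwH (e ▸ hπvH)
  have e : ((shellIn π S (t + 3) (c + 2)).filter fun U =>
        π v ∉ U ∧ w ∈ U ∧ ((U ∩ H).card : ℤ) = y ∧ v ∉ U ∧ π w ∈ U) =
      ((shellIn π S ((t + 1) + 2) (c + 2)).filter fun U => w ∈ U ∧ π w ∈ U ∧
        (v ∉ U \ {w, π w} ∧ π v ∉ U \ {w, π w} ∧ ((((U \ {w, π w}) ∩ H).card : ℕ) : ℤ) = y)) := by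
    refine filter_congr fun U _ => ?_
    constructor
    · rintro ⟨hπvU, hwU, hy, hvU, hπwU⟩
      refine ⟨hwU, hπwU, (mem_sdiff_pair_iff hvw hvπw).not.2 hvU, (mem_sdiff_pair_iff hπvw hπvπw).not.2 hπvU, ?_⟩
      rw [inter_sdiff_pair_of_not_mem hwH hπwH, hy]
    · rintro ⟨hwU, hπwU, hvU, hπvU, hy⟩
      refine ⟨(mem_sdiff_pair_iff hπvw hπvπw).not.1 hπvU, hwU, ?_, (mem_sdiff_pair_iff hvw hvπw).not.1 hvU, hπwU⟩
      rw [inter_sdiff_pair_of_not_mem hwH hπwH] at hy; exact hy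
  rw [e, card_shellIn_full_filter hπ hπ' hS hw (t + 1) (c + 2)
    (fun W => v ∉ W ∧ π v ∉ W ∧ (((W ∩ H).card : ℕ) : ℤ) = y),
    card_shellIn_avoid_filter v (t + 1) (c + 2) (fun W => (((W ∩ H).card : ℕ) : ℤ) = y), sdiff_sdiff_eq_del2']

omit hS hv hπwH in
/-- Pattern B-(avoid, half): `e₁` untouched, `w` half-chosen. [cite: Rothvoss2017, §2 (PDF p. 6)] -/
theorem patB_ah (t c : ℕ) (y : ℤ) :
    ((shellIn π S (t + 3) (c + 2)).filter fun U =>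
        π v ∉ U ∧ w ∈ U ∧ ((U ∩ H).card : ℤ) = y ∧ v ∉ U ∧ π w ∉ U).card =
      ((shellIn π (del2 π S v w) (t + 2) (c + 1)).filter fun W => ((W ∩ H).card : ℤ) = y).card := by
  have hvw : v ≠ w := fun e => hwH (e ▸ hvH)
  have hπvw : π v ≠ w := fun e => hwH (e ▸ hπvH)
  have e : ((shellIn π S (t + 3) (c + 2)).filter fun U =>
        π v ∉ U ∧ w ∈ U ∧ ((U ∩ H).card : ℤ) = y ∧ v ∉ U ∧ π w ∉ U) =
      ((shellIn π S ((t + 2) + 1) ((c + 1) + 1)).filter fun U => w ∈ U ∧ π w ∉ U ∧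
        (v ∉ U.erase w ∧ π v ∉ U.erase w ∧ ((((U.erase w) ∩ H).card : ℕ) : ℤ) = y)) := by
    refine filter_congr fun U _ => ?_
    constructor
    · rintro ⟨hπvU, hwU, hy, hvU, hπwU⟩
      refine ⟨hwU, hπwU, (mem_erase_iff_of_ne hvw).not.2 hvU, (mem_erase_iff_of_ne hπvw).not.2 hπvU, ?_⟩
      rw [inter_erase_of_not_mem hwH, hy]
    · rintro ⟨hwU, hπwU, hvU, hπvU, hy⟩
      refine ⟨(mem_erase_iff_of_ne hπvw).not.1 hπvU, hwU, ?_, (mem_erase_iff_of_ne hvw).not.1 hvU, hπwU⟩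
      rw [inter_erase_of_not_mem hwH] at hy; exact hy
  rw [e, card_shellIn_half_filter hπ hπ' hw (t + 2) (c + 1)
    (fun W => v ∉ W ∧ π v ∉ W ∧ (((W ∩ H).card : ℕ) : ℤ) = y),
    card_shellIn_avoid_filter v (t + 2) (c + 1) (fun W => (((W ∩ H).card : ℕ) : ℤ) = y), sdiff_sdiff_eq_del2']

omit hπ hπ' hS hv hw hvH hπvH hwH hπwH in
/-- Splitting a pinned count by the status of two further vertices. [folklore] -/
private theorem card_filter_split_two (s : Finset (Finset (Fin n))) (P : Finset (Fin n) → Prop) [DecidablePred P] (a b : Fin n) :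
    (((s.filter P).card : ℕ) : ℝ) =
      (((s.filter fun U => P U ∧ a ∈ U ∧ b ∈ U).card : ℕ) : ℝ) + (((s.filter fun U => P U ∧ a ∈ U ∧ b ∉ U).card : ℕ) : ℝ) +
      (((s.filter fun U => P U ∧ a ∉ U ∧ b ∈ U).card : ℕ) : ℝ) + (((s.filter fun U => P U ∧ a ∉ U ∧ b ∉ U).card : ℕ) : ℝ) := by
  simp only [card_filter]
  push_cast
  rw [← sum_add_distrib, ← sum_add_distrib, ← sum_add_distrib]
  refine sum_congr rfl fun U _ => ?_
  by_cases hP : P U <;> by_cases ha : a ∈ U <;> by_cases hb : b ∈ U <;> simp [hP, ha, hb]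

/-- The `A`-count of the swap as four shell counts of `S″`. [cite: Rothvoss2017, §2 (PDF p. 6)] -/
theorem swapA_eq (t c : ℕ) (y : ℤ) :
    ((((shellIn π S (t + 3) (c + 2)).filter fun U => π v ∈ U ∧ w ∉ U ∧ ((U ∩ H).card : ℤ) = y).card : ℕ) : ℝ) =
      shellCount π (del2 π S v w) H t (c + 1) (y - 2) + shellCount π (del2 π S v w) H (t + 1) (c + 2) (y - 2) +
      shellCount π (del2 π S v w) H (t + 1) c (y - 1) + shellCount π (del2 π S v w) H (t + 2) (c + 1) (y - 1) := by
  rw [card_filter_split_two _ _ v (π w)]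
  have e1 := patA_fh hπ hπ' hS hv hw hvH hπvH hwH hπwH t c y
  have e2 := patA_fa hπ hπ' hS hv hvH hπvH hwH hπwH t c y
  have e3 := patA_hh hπ hπ' hS hv hw hvH hπvH hwH hπwH t c y
  have e4 := patA_ha hπ hπ' hS hv hπvH hwH hπwH t c y
  simp only [and_assoc]
  rw [e1, e2, e3, e4]
  rfl

/-- The `B`-count of the swap as four shell counts of `S″`. [cite: Rothvoss2017, §2 (PDF p. 6)] -/
theorem swapB_eq (t c : ℕ) (y : ℤ) :
    ((((shellIn π S (t + 3) (c + 2)).filter fun U => π v ∉ U ∧ w ∈ U ∧ ((U ∩ H).card : ℤ) = y).card : ℕ) : ℝ) =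
      shellCount π (del2 π S v w) H t (c + 1) (y - 1) + shellCount π (del2 π S v w) H (t + 1) c (y - 1) +
      shellCount π (del2 π S v w) H (t + 1) (c + 2) y + shellCount π (del2 π S v w) H (t + 2) (c + 1) y := by
  rw [card_filter_split_two _ _ v (π w)]
  have e1 := patB_hf hπ hπ' hS hv hw hvH hπvH hwH hπwH t c y
  have e2 := patB_hh hπ hπ' hv hw hvH hπvH hwH hπwH t c y
  have e3 := patB_af hπ hπ' hS hw hvH hπvH hwH hπwH t c y
  have e4 := patB_ah hπ hπ' hw hvH hπvH hwH t c y
  simp only [and_assoc]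
  rw [e1, e2, e3, e4]
  rfl

end Patterns

/-! ### §4 The type-step identity -/

/-- **ONE TYPE STEP IS A DIFFERENCE OF TWO SECOND x-DIFFERENCES.** Let `π` be a fixed-point-free involution, `S` a
`π`-stable ground set, `v, w ∈ S` with the edge `{v, πv}` inside `H` and the edge `{w, πw}` disjoint from `H`, and let
`H′ = insert w (H.erase (π v))` (both edges mixed for `H′`, every other edge keeps its type), `S″ = del2 π S v w`. Then for
every cut size `t + 3`, level `c + 2` and `x ∈ ℤ`:
`Sh_{S,H}(t+3,c+2;x) − Sh_{S,H′}(t+3,c+2;x) = ∇̃²Sh_{S″,H}(t+1,c+2;·)(x) − ∇̃²Sh_{S″,H}(t+1,c;·)(x)`,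
`∇̃²r(x) = r(x) − 2r(x−1) + r(x−2)`. (Replacing one `HH` and one `H̄H̄` edge of the type by two mixed edges; the edge-type
companion of `levelStep_shellCount`.) [cite: Rothvoss2017, §2 (PDF pp. 5–6)] [cite: GodsilMeagher2015, §15.2] -/
theorem typeStep_shellCount (hπ : ∀ v, π (π v) = v) (hπ' : ∀ v, π v ≠ v) {S H : Finset (Fin n)}
    (hS : ∀ u ∈ S, π u ∈ S) {v w : Fin n} (hv : v ∈ S) (hw : w ∈ S) (hvH : v ∈ H) (hπvH : π v ∈ H)
    (hwH : w ∉ H) (hπwH : π w ∉ H) (t c : ℕ) (x : ℤ) :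
    shellCount π S H (t + 3) (c + 2) x - shellCount π S (insert w (H.erase (π v))) (t + 3) (c + 2) x =
      (shellCount π (del2 π S v w) H (t + 1) (c + 2) x - 2 * shellCount π (del2 π S v w) H (t + 1) (c + 2) (x - 1) +
          shellCount π (del2 π S v w) H (t + 1) (c + 2) (x - 2)) -
        (shellCount π (del2 π S v w) H (t + 1) c x - 2 * shellCount π (del2 π S v w) H (t + 1) c (x - 1) +
          shellCount π (del2 π S v w) H (t + 1) c (x - 2)) := by
  rw [shellCount_sub_shellCount_swap hπvH hwH (t + 3) (c + 2) x,
    swapA_eq hπ hπ' hS hv hw hvH hπvH hwH hπwH t c x, swapA_eq hπ hπ' hS hv hw hvH hπvH hwH hπwH t c (x + 1),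
    swapB_eq hπ hπ' hS hv hw hvH hπvH hwH hπwH t c x, swapB_eq hπ hπ' hS hv hw hvH hπvH hwH hπwH t c (x - 1)]
  have e1 : x + 1 - 2 = x - 1 := by ring
  have e2 : x + 1 - 1 = x := by ring
  have e3 : x - 1 - 1 = x - 2 := by ring
  rw [e1, e2, e3]
  ring


/-! ### §5 (v2 append) Base level `1`: the second term is absent -/

section PatternsOne

variable (hπ : ∀ v, π (π v) = v) (hπ' : ∀ v, π v ≠ v) {S H : Finset (Fin n)} (hS : ∀ u ∈ S, π u ∈ S)
  {v w : Fin n} (hv : v ∈ S) (hw : w ∈ S) (hvH : v ∈ H) (hπvH : π v ∈ H) (hwH : w ∉ H) (hπwH : π w ∉ H)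
include hπ hπ' hS hv hw hvH hπvH hwH hπwH

omit hw in
/-- Pattern A-(full, avoid) at base level `1`. [cite: Rothvoss2017, §2 (PDF p. 6)] -/
theorem patA_fa_one (t : ℕ) (y : ℤ) :
    ((shellIn π S (t + 3) 1).filter fun U =>
        π v ∈ U ∧ w ∉ U ∧ ((U ∩ H).card : ℤ) = y ∧ v ∈ U ∧ π w ∉ U).card =
      ((shellIn π (del2 π S v w) (t + 1) 1).filter fun W => ((W ∩ H).card : ℤ) = y - 2).card := by
  have hwv : w ≠ v := fun e => hwH (e ▸ hvH)
  have hwπv : w ≠ π v := fun e => hwH (e ▸ hπvH)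
  have hπwv : π w ≠ v := fun e => hπwH (e ▸ hvH)
  have hπwπv : π w ≠ π v := fun e => hπwH (e ▸ hπvH)
  have e : ((shellIn π S (t + 3) 1).filter fun U =>
        π v ∈ U ∧ w ∉ U ∧ ((U ∩ H).card : ℤ) = y ∧ v ∈ U ∧ π w ∉ U) =
      ((shellIn π S ((t + 1) + 2) 1).filter fun U => v ∈ U ∧ π v ∈ U ∧
        (w ∉ U \ {v, π v} ∧ π w ∉ U \ {v, π v} ∧ ((((U \ {v, π v}) ∩ H).card : ℕ) : ℤ) = y - 2)) := by
    refine filter_congr fun U _ => ?_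
    constructor
    · rintro ⟨hπvU, hwU, hy, hvU, hπwU⟩
      refine ⟨hvU, hπvU, (mem_sdiff_pair_iff hwv hwπv).not.2 hwU, (mem_sdiff_pair_iff hπwv hπwπv).not.2 hπwU, ?_⟩
      rw [card_inter_sdiff_pair_of_mem hπ' hvH hπvH hvU hπvU, hy]
    · rintro ⟨hvU, hπvU, hwU, hπwU, hy⟩
      refine ⟨hπvU, (mem_sdiff_pair_iff hwv hwπv).not.1 hwU, ?_, hvU, (mem_sdiff_pair_iff hπwv hπwπv).not.1 hπwU⟩
      rw [card_inter_sdiff_pair_of_mem hπ' hvH hπvH hvU hπvU] at hy; omega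
  rw [e, card_shellIn_full_filter hπ hπ' hS hv (t + 1) 1
    (fun W => w ∉ W ∧ π w ∉ W ∧ (((W ∩ H).card : ℕ) : ℤ) = y - 2),
    card_shellIn_avoid_filter w (t + 1) 1 (fun W => (((W ∩ H).card : ℕ) : ℤ) = y - 2), sdiff_sdiff_eq_del2]

/-- Pattern A-(full, half) at base level `1`. [cite: Rothvoss2017, §2 (PDF p. 6)] -/
theorem patA_fh_one (t : ℕ) (y : ℤ) :
    ((shellIn π S (t + 3) 1).filter fun U =>
        π v ∈ U ∧ w ∉ U ∧ ((U ∩ H).card : ℤ) = y ∧ v ∈ U ∧ π w ∈ U).card =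
      ((shellIn π (del2 π S v w) t 0).filter fun W => ((W ∩ H).card : ℤ) = y - 2).card := by
  have hwv : w ≠ v := fun e => hwH (e ▸ hvH)
  have hwπv : w ≠ π v := fun e => hwH (e ▸ hπvH)
  have hπwv : π w ≠ v := fun e => hπwH (e ▸ hvH)
  have hπwπv : π w ≠ π v := fun e => hπwH (e ▸ hπvH)
  have hπw : π w ∈ S \ {v, π v} := (mem_sdiff_pair_iff hπwv hπwπv).2 (hS w hw)
  have e : ((shellIn π S (t + 3) 1).filter fun U =>
        π v ∈ U ∧ w ∉ U ∧ ((U ∩ H).card : ℤ) = y ∧ v ∈ U ∧ π w ∈ U) =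
      ((shellIn π S ((t + 1) + 2) (0 + 1)).filter fun U => v ∈ U ∧ π v ∈ U ∧
        (π w ∈ U \ {v, π v} ∧ π (π w) ∉ U \ {v, π v} ∧
          (((((U \ {v, π v}).erase (π w)) ∩ H).card : ℕ) : ℤ) = y - 2)) := by
    refine filter_congr fun U _ => ?_
    rw [hπ w]
    constructor
    · rintro ⟨hπvU, hwU, hy, hvU, hπwU⟩
      refine ⟨hvU, hπvU, (mem_sdiff_pair_iff hπwv hπwπv).2 hπwU, (mem_sdiff_pair_iff hwv hwπv).not.2 hwU, ?_⟩
      rw [inter_erase_of_not_mem hπwH, card_inter_sdiff_pair_of_mem hπ' hvH hπvH hvU hπvU, hy]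
    · rintro ⟨hvU, hπvU, hπwU, hwU, hy⟩
      refine ⟨hπvU, (mem_sdiff_pair_iff hwv hwπv).not.1 hwU, ?_, hvU, (mem_sdiff_pair_iff hπwv hπwπv).1 hπwU⟩
      rw [inter_erase_of_not_mem hπwH, card_inter_sdiff_pair_of_mem hπ' hvH hπvH hvU hπvU] at hy; omega
  rw [e, card_shellIn_full_filter hπ hπ' hS hv (t + 1) (0 + 1)
    (fun W => π w ∈ W ∧ π (π w) ∉ W ∧ ((((W.erase (π w)) ∩ H).card : ℕ) : ℤ) = y - 2),
    card_shellIn_half_filter hπ hπ' hπw t 0 (fun W => (((W ∩ H).card : ℕ) : ℤ) = y - 2),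
    sdiff_pair_partner hπ, sdiff_sdiff_eq_del2]

omit hw hvH in
/-- Pattern A-(half, avoid) at base level `1`. [cite: Rothvoss2017, §2 (PDF p. 6)] -/
theorem patA_ha_one (t : ℕ) (y : ℤ) :
    ((shellIn π S (t + 3) 1).filter fun U =>
        π v ∈ U ∧ w ∉ U ∧ ((U ∩ H).card : ℤ) = y ∧ v ∉ U ∧ π w ∉ U).card =
      ((shellIn π (del2 π S v w) (t + 2) 0).filter fun W => ((W ∩ H).card : ℤ) = y - 1).card := by
  have hwπv : w ≠ π v := fun e => hwH (e ▸ hπvH)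
  have hπwπv : π w ≠ π v := fun e => hπwH (e ▸ hπvH)
  have hπv : π v ∈ S := hS v hv
  have e : ((shellIn π S (t + 3) 1).filter fun U =>
        π v ∈ U ∧ w ∉ U ∧ ((U ∩ H).card : ℤ) = y ∧ v ∉ U ∧ π w ∉ U) =
      ((shellIn π S ((t + 2) + 1) (0 + 1)).filter fun U => π v ∈ U ∧ π (π v) ∉ U ∧
        (w ∉ U.erase (π v) ∧ π w ∉ U.erase (π v) ∧ ((((U.erase (π v)) ∩ H).card : ℕ) : ℤ) = y - 1)) := by
    refine filter_congr fun U _ => ?_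
    rw [hπ v]
    constructor
    · rintro ⟨hπvU, hwU, hy, hvU, hπwU⟩
      refine ⟨hπvU, hvU, (mem_erase_iff_of_ne hwπv).not.2 hwU, (mem_erase_iff_of_ne hπwπv).not.2 hπwU, ?_⟩
      rw [card_inter_erase_of_mem hπvH hπvU, hy]
    · rintro ⟨hπvU, hvU, hwU, hπwU, hy⟩
      refine ⟨hπvU, (mem_erase_iff_of_ne hwπv).not.1 hwU, ?_, hvU, (mem_erase_iff_of_ne hπwπv).not.1 hπwU⟩
      rw [card_inter_erase_of_mem hπvH hπvU] at hy; omega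
  rw [e, card_shellIn_half_filter hπ hπ' hπv (t + 2) 0
    (fun W => w ∉ W ∧ π w ∉ W ∧ (((W ∩ H).card : ℕ) : ℤ) = y - 1),
    sdiff_pair_partner hπ,
    card_shellIn_avoid_filter w (t + 2) 0 (fun W => (((W ∩ H).card : ℕ) : ℤ) = y - 1), sdiff_sdiff_eq_del2]

/-- Pattern B-(half, full) at base level `1`. [cite: Rothvoss2017, §2 (PDF p. 6)] -/
theorem patB_hf_one (t : ℕ) (y : ℤ) :
    ((shellIn π S (t + 3) 1).filter fun U =>
        π v ∉ U ∧ w ∈ U ∧ ((U ∩ H).card : ℤ) = y ∧ v ∈ U ∧ π w ∈ U).card =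
      ((shellIn π (del2 π S v w) t 0).filter fun W => ((W ∩ H).card : ℤ) = y - 1).card := by
  have hvw : v ≠ w := fun e => hwH (e ▸ hvH)
  have hvπw : v ≠ π w := fun e => hπwH (e ▸ hvH)
  have hπvw : π v ≠ w := fun e => hwH (e ▸ hπvH)
  have hπvπw : π v ≠ π w := fun e => hπwH (e ▸ hπvH)
  have hv' : v ∈ S \ {w, π w} := (mem_sdiff_pair_iff hvw hvπw).2 hv
  have e : ((shellIn π S (t + 3) 1).filter fun U =>
        π v ∉ U ∧ w ∈ U ∧ ((U ∩ H).card : ℤ) = y ∧ v ∈ U ∧ π w ∈ U) =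
      ((shellIn π S ((t + 1) + 2) (0 + 1)).filter fun U => w ∈ U ∧ π w ∈ U ∧
        (v ∈ U \ {w, π w} ∧ π v ∉ U \ {w, π w} ∧ (((((U \ {w, π w}).erase v) ∩ H).card : ℕ) : ℤ) = y - 1)) := by
    refine filter_congr fun U _ => ?_
    constructor
    · rintro ⟨hπvU, hwU, hy, hvU, hπwU⟩
      refine ⟨hwU, hπwU, (mem_sdiff_pair_iff hvw hvπw).2 hvU, (mem_sdiff_pair_iff hπvw hπvπw).not.2 hπvU, ?_⟩
      rw [card_inter_erase_of_mem hvH ((mem_sdiff_pair_iff hvw hvπw).2 hvU), inter_sdiff_pair_of_not_mem hwH hπwH, hy]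
    · rintro ⟨hwU, hπwU, hvU, hπvU, hy⟩
      have hvU' : v ∈ U := (mem_sdiff_pair_iff hvw hvπw).1 hvU
      refine ⟨(mem_sdiff_pair_iff hπvw hπvπw).not.1 hπvU, hwU, ?_, hvU', hπwU⟩
      rw [card_inter_erase_of_mem hvH hvU, inter_sdiff_pair_of_not_mem hwH hπwH] at hy; omega
  rw [e, card_shellIn_full_filter hπ hπ' hS hw (t + 1) (0 + 1)
    (fun W => v ∈ W ∧ π v ∉ W ∧ ((((W.erase v) ∩ H).card : ℕ) : ℤ) = y - 1),
    card_shellIn_half_filter hπ hπ' hv' t 0 (fun W => (((W ∩ H).card : ℕ) : ℤ) = y - 1),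
    sdiff_sdiff_eq_del2']

omit hv in
/-- Pattern B-(avoid, full) at base level `1`. [cite: Rothvoss2017, §2 (PDF p. 6)] -/
theorem patB_af_one (t : ℕ) (y : ℤ) :
    ((shellIn π S (t + 3) 1).filter fun U =>
        π v ∉ U ∧ w ∈ U ∧ ((U ∩ H).card : ℤ) = y ∧ v ∉ U ∧ π w ∈ U).card =
      ((shellIn π (del2 π S v w) (t + 1) 1).filter fun W => ((W ∩ H).card : ℤ) = y).card := by
  have hvw : v ≠ w := fun e => hwH (e ▸ hvH)
  have hvπw : v ≠ π w := fun e => hπwH (e ▸ hvH)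
  have hπvw : π v ≠ w := fun e => hwH (e ▸ hπvH)
  have hπvπw : π v ≠ π w := fun e => hπwH (e ▸ hπvH)
  have e : ((shellIn π S (t + 3) 1).filter fun U =>
        π v ∉ U ∧ w ∈ U ∧ ((U ∩ H).card : ℤ) = y ∧ v ∉ U ∧ π w ∈ U) =
      ((shellIn π S ((t + 1) + 2) 1).filter fun U => w ∈ U ∧ π w ∈ U ∧
        (v ∉ U \ {w, π w} ∧ π v ∉ U \ {w, π w} ∧ ((((U \ {w, π w}) ∩ H).card : ℕ) : ℤ) = y)) := by
    refine filter_congr fun U _ => ?_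
    constructor
    · rintro ⟨hπvU, hwU, hy, hvU, hπwU⟩
      refine ⟨hwU, hπwU, (mem_sdiff_pair_iff hvw hvπw).not.2 hvU, (mem_sdiff_pair_iff hπvw hπvπw).not.2 hπvU, ?_⟩
      rw [inter_sdiff_pair_of_not_mem hwH hπwH, hy]
    · rintro ⟨hwU, hπwU, hvU, hπvU, hy⟩
      refine ⟨(mem_sdiff_pair_iff hπvw hπvπw).not.1 hπvU, hwU, ?_, (mem_sdiff_pair_iff hvw hvπw).not.1 hvU, hπwU⟩
      rw [inter_sdiff_pair_of_not_mem hwH hπwH] at hy; exact hy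
  rw [e, card_shellIn_full_filter hπ hπ' hS hw (t + 1) 1
    (fun W => v ∉ W ∧ π v ∉ W ∧ (((W ∩ H).card : ℕ) : ℤ) = y),
    card_shellIn_avoid_filter v (t + 1) 1 (fun W => (((W ∩ H).card : ℕ) : ℤ) = y), sdiff_sdiff_eq_del2']

omit hS hv hπwH in
/-- Pattern B-(avoid, half) at base level `1`. [cite: Rothvoss2017, §2 (PDF p. 6)] -/
theorem patB_ah_one (t : ℕ) (y : ℤ) :
    ((shellIn π S (t + 3) 1).filter fun U =>
        π v ∉ U ∧ w ∈ U ∧ ((U ∩ H).card : ℤ) = y ∧ v ∉ U ∧ π w ∉ U).card =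
      ((shellIn π (del2 π S v w) (t + 2) 0).filter fun W => ((W ∩ H).card : ℤ) = y).card := by
  have hvw : v ≠ w := fun e => hwH (e ▸ hvH)
  have hπvw : π v ≠ w := fun e => hwH (e ▸ hπvH)
  have e : ((shellIn π S (t + 3) 1).filter fun U =>
        π v ∉ U ∧ w ∈ U ∧ ((U ∩ H).card : ℤ) = y ∧ v ∉ U ∧ π w ∉ U) =
      ((shellIn π S ((t + 2) + 1) (0 + 1)).filter fun U => w ∈ U ∧ π w ∉ U ∧
        (v ∉ U.erase w ∧ π v ∉ U.erase w ∧ ((((U.erase w) ∩ H).card : ℕ) : ℤ) = y)) := by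
    refine filter_congr fun U _ => ?_
    constructor
    · rintro ⟨hπvU, hwU, hy, hvU, hπwU⟩
      refine ⟨hwU, hπwU, (mem_erase_iff_of_ne hvw).not.2 hvU, (mem_erase_iff_of_ne hπvw).not.2 hπvU, ?_⟩
      rw [inter_erase_of_not_mem hwH, hy]
    · rintro ⟨hwU, hπwU, hvU, hπvU, hy⟩
      refine ⟨(mem_erase_iff_of_ne hπvw).not.1 hπvU, hwU, ?_, (mem_erase_iff_of_ne hvw).not.1 hvU, hπwU⟩
      rw [inter_erase_of_not_mem hwH] at hy; exact hy
  rw [e, card_shellIn_half_filter hπ hπ' hw (t + 2) 0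
    (fun W => v ∉ W ∧ π v ∉ W ∧ (((W ∩ H).card : ℕ) : ℤ) = y),
    card_shellIn_avoid_filter v (t + 2) 0 (fun W => (((W ∩ H).card : ℕ) : ℤ) = y), sdiff_sdiff_eq_del2']

omit hπ' hS hv hw hvH hwH in
/-- At base level `1` no cut has two half-chosen vertices: pattern A-(half, half) is empty. [cite: Rothvoss2017, §2 (PDF p. 6)] -/
theorem patA_hh_one (t : ℕ) (y : ℤ) :
    ((shellIn π S (t + 3) 1).filter fun U =>
        π v ∈ U ∧ w ∉ U ∧ ((U ∩ H).card : ℤ) = y ∧ v ∉ U ∧ π w ∈ U).card = 0 := by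
  rw [card_eq_zero, filter_eq_empty_iff]
  rintro U hU ⟨hπvU, hwU, -, hvU, hπwU⟩
  obtain ⟨_, _, hUc⟩ := mem_shellIn.1 hU
  have h1 : π v ∈ half π U := mem_half.2 ⟨hπvU, by rw [hπ]; exact hvU⟩
  have h2 : π w ∈ half π U := mem_half.2 ⟨hπwU, by rw [hπ]; exact hwU⟩
  have hne : π v ≠ π w := fun e => hπwH (e ▸ hπvH)
  have hsub : ({π v, π w} : Finset (Fin n)) ⊆ half π U := by
    intro u hu
    rcases mem_insert.1 hu with rfl | hu
    · exact h1
    · rw [mem_singleton] at hu; subst hu; exact h2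
  have := card_le_card hsub
  rw [card_pair hne] at this
  omega

omit hπ hπ' hS hv hw hπvH hπwH in
/-- At base level `1` no cut has two half-chosen vertices: pattern B-(half, half) is empty. [cite: Rothvoss2017, §2 (PDF p. 6)] -/
theorem patB_hh_one (t : ℕ) (y : ℤ) :
    ((shellIn π S (t + 3) 1).filter fun U =>
        π v ∉ U ∧ w ∈ U ∧ ((U ∩ H).card : ℤ) = y ∧ v ∈ U ∧ π w ∉ U).card = 0 := by
  rw [card_eq_zero, filter_eq_empty_iff]
  rintro U hU ⟨hπvU, hwU, -, hvU, hπwU⟩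
  obtain ⟨_, _, hUc⟩ := mem_shellIn.1 hU
  have h1 : v ∈ half π U := mem_half.2 ⟨hvU, hπvU⟩
  have h2 : w ∈ half π U := mem_half.2 ⟨hwU, hπwU⟩
  have hne : v ≠ w := fun e => hwH (e ▸ hvH)
  have hsub : ({v, w} : Finset (Fin n)) ⊆ half π U := by
    intro u hu
    rcases mem_insert.1 hu with rfl | hu
    · exact h1
    · rw [mem_singleton] at hu; subst hu; exact h2
  have := card_le_card hsub
  rw [card_pair hne] at this
  omega

/-- The `A`-count of the swap at base level `1`. [cite: Rothvoss2017, §2 (PDF p. 6)] -/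
theorem swapA_eq_one (t : ℕ) (y : ℤ) :
    ((((shellIn π S (t + 3) 1).filter fun U => π v ∈ U ∧ w ∉ U ∧ ((U ∩ H).card : ℤ) = y).card : ℕ) : ℝ) =
      shellCount π (del2 π S v w) H t 0 (y - 2) + shellCount π (del2 π S v w) H (t + 1) 1 (y - 2) +
      shellCount π (del2 π S v w) H (t + 2) 0 (y - 1) := by
  rw [card_filter_split_two _ _ v (π w)]
  have e1 := patA_fh_one hπ hπ' hS hv hw hvH hπvH hwH hπwH t y
  have e2 := patA_fa_one hπ hπ' hS hv hvH hπvH hwH hπwH t y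
  have e3 := patA_hh_one (S := S) hπ hπvH hπwH t y
  have e4 := patA_ha_one hπ hπ' hS hv hπvH hwH hπwH t y
  simp only [and_assoc]
  rw [e1, e2, e3, e4, Nat.cast_zero, add_zero]
  rfl

/-- The `B`-count of the swap at base level `1`. [cite: Rothvoss2017, §2 (PDF p. 6)] -/
theorem swapB_eq_one (t : ℕ) (y : ℤ) :
    ((((shellIn π S (t + 3) 1).filter fun U => π v ∉ U ∧ w ∈ U ∧ ((U ∩ H).card : ℤ) = y).card : ℕ) : ℝ) =
      shellCount π (del2 π S v w) H t 0 (y - 1) +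
      shellCount π (del2 π S v w) H (t + 1) 1 y + shellCount π (del2 π S v w) H (t + 2) 0 y := by
  rw [card_filter_split_two _ _ v (π w)]
  have e1 := patB_hf_one hπ hπ' hS hv hw hvH hπvH hwH hπwH t y
  have e2 := patB_hh_one (π := π) (S := S) hvH hwH t y
  have e3 := patB_af_one hπ hπ' hS hw hvH hπvH hwH hπwH t y
  have e4 := patB_ah_one hπ hπ' hw hvH hπvH hwH t y
  simp only [and_assoc]
  rw [e1, e2, e3, e4, Nat.cast_zero, add_zero]
  rfl

end PatternsOne

/-- **THE TYPE STEP AT BASE LEVEL `1`** (the base level of the remainder chain): with the notation of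
`typeStep_shellCount`, `Sh_{S,H}(t+3,1;x) − Sh_{S,H′}(t+3,1;x) = ∇̃²Sh_{S″,H}(t+1,1;·)(x)` — the second term is absent because
no cut of level `1` has two half-chosen vertices. [cite: Rothvoss2017, §2 (PDF pp. 5–6)] [cite: GodsilMeagher2015, §15.2] -/
theorem typeStep_shellCount_one (hπ : ∀ v, π (π v) = v) (hπ' : ∀ v, π v ≠ v) {S H : Finset (Fin n)}
    (hS : ∀ u ∈ S, π u ∈ S) {v w : Fin n} (hv : v ∈ S) (hw : w ∈ S) (hvH : v ∈ H) (hπvH : π v ∈ H)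
    (hwH : w ∉ H) (hπwH : π w ∉ H) (t : ℕ) (x : ℤ) :
    shellCount π S H (t + 3) 1 x - shellCount π S (insert w (H.erase (π v))) (t + 3) 1 x =
      shellCount π (del2 π S v w) H (t + 1) 1 x - 2 * shellCount π (del2 π S v w) H (t + 1) 1 (x - 1) +
        shellCount π (del2 π S v w) H (t + 1) 1 (x - 2) := by
  rw [shellCount_sub_shellCount_swap hπvH hwH (t + 3) 1 x,
    swapA_eq_one hπ hπ' hS hv hw hvH hπvH hwH hπwH t x, swapA_eq_one hπ hπ' hS hv hw hvH hπvH hwH hπwH t (x + 1),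
    swapB_eq_one hπ hπ' hS hv hw hvH hπvH hwH hπwH t x, swapB_eq_one hπ hπ' hS hv hw hvH hπvH hwH hπwH t (x - 1)]
  have e1 : x + 1 - 2 = x - 1 := by ring
  have e2 : x + 1 - 1 = x := by ring
  have e3 : x - 1 - 1 = x - 2 := by ring
  rw [e1, e2, e3]
  ring


/-! ### §6 (v3 append) Type invariance: the shell count depends only on the type counts -/

section Transport

variable (hπ : ∀ v, π (π v) = v) (hπ' : ∀ v, π v ≠ v)
include hπ hπ'

omit hπ hπ' in
/-- The type classes of a ground set with a pair removed. [cite: Rothvoss2017, §2 (PDF p. 5)] -/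
private theorem vAA_sdiff (S H P : Finset (Fin n)) : vAA π (S \ P) H = vAA π S H \ P := by
  ext u; simp only [mem_vAA, mem_sdiff]; tauto

omit hπ hπ' in
/-- The type classes of a ground set with a pair removed. [cite: Rothvoss2017, §2 (PDF p. 5)] -/
private theorem vBH_sdiff (S H P : Finset (Fin n)) : vBH π (S \ P) H = vBH π S H \ P := by
  ext u; simp only [mem_vBH, mem_sdiff]; tauto

omit hπ hπ' in
/-- The type classes of a ground set with a pair removed. [cite: Rothvoss2017, §2 (PDF p. 5)] -/
private theorem vDD_sdiff (S H P : Finset (Fin n)) : vDD π (S \ P) H = vDD π S H \ P := by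
  ext u; simp only [mem_vDD, mem_sdiff]; tauto

omit hπ hπ' in
/-- Removing a pair contained in a class lowers its size by `2`; removing a disjoint pair keeps it. [folklore] -/
private theorem card_sdiff_pair_cases {C : Finset (Fin n)} {u z : Fin n} (huz : u ≠ z) :
    (u ∈ C → z ∈ C → (C \ {u, z}).card + 2 = C.card) ∧ (u ∉ C → z ∉ C → C \ {u, z} = C) ∧
      (u ∈ C → z ∉ C → (C \ {u, z}).card + 1 = C.card) := by
  refine ⟨fun hu hz => ?_, fun hu hz => ?_, fun hu hz => ?_⟩
  · have hsub : ({u, z} : Finset (Fin n)) ⊆ C := by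
      intro a ha
      rcases mem_insert.1 ha with rfl | ha
      · exact hu
      · rw [mem_singleton] at ha; subst ha; exact hz
    rw [card_sdiff_of_subset hsub, card_pair huz]
    have := card_le_card hsub
    rw [card_pair huz] at this
    omega
  · exact sdiff_eq_self_of_disjoint (disjoint_left.2 fun a haC haP => by
      rcases mem_insert.1 haP with rfl | ha
      · exact hu haC
      · rw [mem_singleton] at ha; subst ha; exact hz haC)
  · have e : C \ {u, z} = C.erase u := by
      ext a; simp only [mem_sdiff, mem_insert, mem_singleton, not_or, mem_erase]
      constructor
      · rintro ⟨haC, hau, _⟩; exact ⟨hau, haC⟩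
      · rintro ⟨hau, haC⟩; exact ⟨haC, hau, fun h => hz (h ▸ haC)⟩
    rw [e, card_erase_add_one hu]

omit hπ' in
/-- Shell counts of the empty ground set do not see the block. [cite: Rothvoss2017, §2 (PDF p. 6)] -/
private theorem shellCount_empty (H₁ H₂ : Finset (Fin n)) (T C : ℕ) (x : ℤ) :
    shellCount π ∅ H₁ T C x = shellCount π ∅ H₂ T C x := by
  have _ := hπ
  unfold shellCount
  congr 1
  refine congrArg _ (filter_congr fun U hU => ?_)
  have hU0 : U = ∅ := subset_empty.1 (mem_shellIn.1 hU).1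
  subst hU0; simp

/-- The four pieces of the one-edge decomposition, with the block count carried. [cite: Rothvoss2017, §2 (PDF p. 6)] -/
private theorem piece_avoid (S H : Finset (Fin n)) (u : Fin n) (T C : ℕ) (x : ℤ) :
    ((shellIn π S T C).filter fun U => ((U ∩ H).card : ℤ) = x ∧ u ∉ U ∧ π u ∉ U).card =
      ((shellIn π (S \ {u, π u}) T C).filter fun W => ((W ∩ H).card : ℤ) = x).card := by
  have _ := hπ; have _ := hπ'
  rw [← card_shellIn_avoid_filter u T C (fun W => (((W ∩ H).card : ℕ) : ℤ) = x)]
  exact congrArg _ (filter_congr fun U _ => by tauto)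

/-- Half pattern at `u` with the block count carried: the count shifts by `|{u} ∩ H|`. [cite: Rothvoss2017, §2 (PDF p. 6)] -/
private theorem piece_half {S H : Finset (Fin n)} {u : Fin n} (hu : u ∈ S) (T C : ℕ) (x : ℤ) :
    ((shellIn π S (T + 1) (C + 1)).filter fun U => ((U ∩ H).card : ℤ) = x ∧ u ∈ U ∧ π u ∉ U).card =
      ((shellIn π (S \ {u, π u}) T C).filter fun W => ((W ∩ H).card : ℤ) = x - ((({u} ∩ H : Finset (Fin n)).card : ℕ) : ℤ)).card := by
  have hcnt : ∀ U : Finset (Fin n), u ∈ U →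
      ((((U.erase u) ∩ H).card : ℕ) : ℤ) = ((U ∩ H).card : ℤ) - ((({u} ∩ H : Finset (Fin n)).card : ℕ) : ℤ) := by
    intro U huU
    by_cases huH : u ∈ H
    · rw [card_inter_erase_of_mem huH huU, singleton_inter_of_mem huH, card_singleton]; rfl
    · rw [inter_erase_of_not_mem huH, singleton_inter_of_notMem huH, card_empty]; simp
  rw [← card_shellIn_half_filter hπ hπ' hu T C (fun W => (((W ∩ H).card : ℕ) : ℤ) = x - ((({u} ∩ H : Finset (Fin n)).card : ℕ) : ℤ))]
  exact congrArg _ (filter_congr fun U _ => by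
    constructor
    · rintro ⟨hx, huU, hπuU⟩; exact ⟨huU, hπuU, by rw [hcnt U huU, hx]⟩
    · rintro ⟨huU, hπuU, hx⟩; refine ⟨?_, huU, hπuU⟩; rw [hcnt U huU] at hx; omega)

/-- Half pattern at `π u` with the block count carried. [cite: Rothvoss2017, §2 (PDF p. 6)] -/
private theorem piece_half' {S H : Finset (Fin n)} (hS : ∀ v ∈ S, π v ∈ S) {u : Fin n} (hu : u ∈ S)
    (T C : ℕ) (x : ℤ) :
    ((shellIn π S (T + 1) (C + 1)).filter fun U => ((U ∩ H).card : ℤ) = x ∧ u ∉ U ∧ π u ∈ U).card =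
      ((shellIn π (S \ {u, π u}) T C).filter fun W =>
        ((W ∩ H).card : ℤ) = x - ((({π u} ∩ H : Finset (Fin n)).card : ℕ) : ℤ)).card := by
  have h := piece_half hπ hπ' (H := H) (hS u hu) T C x
  rw [sdiff_pair_partner hπ] at h
  rw [← h]
  exact congrArg _ (filter_congr fun U _ => by rw [hπ u]; tauto)

/-- Full pattern with the block count carried: the count shifts by `|e ∩ H|`. [cite: Rothvoss2017, §2 (PDF p. 6)] -/
private theorem piece_full {S H : Finset (Fin n)} (hS : ∀ v ∈ S, π v ∈ S) {u : Fin n} (hu : u ∈ S) (T C : ℕ)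
    (x : ℤ) :
    ((shellIn π S (T + 2) C).filter fun U => ((U ∩ H).card : ℤ) = x ∧ u ∈ U ∧ π u ∈ U).card =
      ((shellIn π (S \ {u, π u}) T C).filter fun W =>
        ((W ∩ H).card : ℤ) = x - ((({u, π u} ∩ H : Finset (Fin n)).card : ℕ) : ℤ)).card := by
  rw [← card_shellIn_full_filter hπ hπ' hS hu T C
    (fun W => (((W ∩ H).card : ℕ) : ℤ) = x - ((({u, π u} ∩ H : Finset (Fin n)).card : ℕ) : ℤ))]
  exact congrArg _ (filter_congr fun U _ => by
    constructor
    · rintro ⟨hx, huU, hπuU⟩; exact ⟨huU, hπuU, by rw [card_inter_sdiff_pair huU hπuU, hx]⟩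
    · rintro ⟨huU, hπuU, hx⟩; refine ⟨?_, huU, hπuU⟩; rw [card_inter_sdiff_pair huU hπuU] at hx; omega)

omit hπ in
/-- Half patterns are empty at cut size `0` or level `0`. [cite: Rothvoss2017, §2 (PDF p. 6)] -/
private theorem piece_half_zero (S H : Finset (Fin n)) (u : Fin n) {T C : ℕ} (h : T = 0 ∨ C = 0) (x : ℤ) :
    ((shellIn π S T C).filter fun U => ((U ∩ H).card : ℤ) = x ∧ u ∈ U ∧ π u ∉ U).card = 0 ∧
      ((shellIn π S T C).filter fun U => ((U ∩ H).card : ℤ) = x ∧ π u ∉ U ∧ u ∈ U).card = 0 := by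
  have _ := hπ'
  have h0 := card_shellIn_half_eq_zero (π := π) (S := S) u h
  constructor <;>
  · refine Nat.eq_zero_of_le_zero (le_trans (card_le_card fun U hU => ?_) h0.le)
    simp only [mem_filter] at hU ⊢; tauto

omit hπ in
/-- The full pattern is empty at cut size `≤ 1`. [cite: Rothvoss2017, §2 (PDF p. 6)] -/
private theorem piece_full_zero (S H : Finset (Fin n)) (u : Fin n) {T C : ℕ} (h : T ≤ 1) (x : ℤ) :
    ((shellIn π S T C).filter fun U => ((U ∩ H).card : ℤ) = x ∧ u ∈ U ∧ π u ∈ U).card = 0 := by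
  have h0 := card_shellIn_full_eq_zero (π := π) (S := S) hπ' u (c := C) h
  refine Nat.eq_zero_of_le_zero (le_trans (card_le_card fun U hU => ?_) h0.le)
  simp only [mem_filter] at hU ⊢; tauto

/-- **TYPE INVARIANCE OF THE SHELL COUNT.** For `π`-stable ground sets `S₁, S₂` and blocks `H₁, H₂` with the same type
counts (`|vAA|`, `|vBH|`, `|vDD|` — numbers of `HH` edges ×2, mixed edges, `H̄H̄` edges ×2), the shell counts agree:
`Sh_{S₁,H₁}(T,C;x) = Sh_{S₂,H₂}(T,C;x)` for all `T, C, x`. (Induction on `|S₁|`: decompose by an edge of the same class in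
both configurations — avoid / half at either end / full — with the block count carried; each piece is a shell count of a
smaller configuration of matching type.) [cite: Rothvoss2017, §2 (PDF pp. 5–6)] [cite: GodsilMeagher2015, §15.2] -/
theorem shellCount_eq_of_types_eq :
    ∀ (m : ℕ) {S₁ S₂ H₁ H₂ : Finset (Fin n)}, S₁.card = m → (∀ v ∈ S₁, π v ∈ S₁) → (∀ v ∈ S₂, π v ∈ S₂) →
      (vAA π S₁ H₁).card = (vAA π S₂ H₂).card → (vBH π S₁ H₁).card = (vBH π S₂ H₂).card →
      (vDD π S₁ H₁).card = (vDD π S₂ H₂).card →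
      ∀ (T C : ℕ) (x : ℤ), shellCount π S₁ H₁ T C x = shellCount π S₂ H₂ T C x := by
  intro m
  induction m using Nat.strong_induction_on with
  | _ m ih =>
  intro S₁ S₂ H₁ H₂ hm hS₁ hS₂ hAA hBH hDD T C x
  have hBN : (vBN π S₁ H₁).card = (vBN π S₂ H₂).card := by
    rw [← card_vBH_eq_card_vBN hπ hS₁, ← card_vBH_eq_card_vBN hπ hS₂, hBH]
  have hcard : S₁.card = S₂.card := by
    rw [← card_types_eq (π := π) S₁ H₁, ← card_types_eq (π := π) S₂ H₂, hAA, hBH, hBN, hDD]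
  rcases S₁.eq_empty_or_nonempty with h0 | ⟨u₀, hu₀⟩
  · subst h0
    have : S₂ = ∅ := by rw [← card_eq_zero, ← hcard, card_empty]
    subst this
    exact shellCount_empty hπ H₁ H₂ T C x
  -- choose `u₁ ∈ S₁` NOT in `vBN` (replace a non-`H` end of a mixed edge by its partner) and `u₂ ∈ S₂` of the same class
  obtain ⟨u₁, hu₁, hcls⟩ : ∃ u₁ ∈ S₁, (u₁ ∈ H₁ ∧ π u₁ ∈ H₁) ∨ (u₁ ∈ H₁ ∧ π u₁ ∉ H₁) ∨ (u₁ ∉ H₁ ∧ π u₁ ∉ H₁) := by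
    by_cases h1 : u₀ ∈ H₁
    · by_cases h2 : π u₀ ∈ H₁
      · exact ⟨u₀, hu₀, Or.inl ⟨h1, h2⟩⟩
      · exact ⟨u₀, hu₀, Or.inr (Or.inl ⟨h1, h2⟩)⟩
    · by_cases h2 : π u₀ ∈ H₁
      · exact ⟨π u₀, hS₁ u₀ hu₀, Or.inr (Or.inl ⟨h2, by rw [hπ]; exact h1⟩)⟩
      · exact ⟨u₀, hu₀, Or.inr (Or.inr ⟨h1, h2⟩)⟩
  -- a vertex `u₂ ∈ S₂` with the same class data
  obtain ⟨u₂, hu₂, hsame⟩ : ∃ u₂ ∈ S₂, (u₁ ∈ H₁ ↔ u₂ ∈ H₂) ∧ (π u₁ ∈ H₁ ↔ π u₂ ∈ H₂) := by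
    rcases hcls with ⟨h1, h2⟩ | ⟨h1, h2⟩ | ⟨h1, h2⟩
    · have hne : (vAA π S₂ H₂).Nonempty := by
        rw [← card_pos, ← hAA, card_pos]; exact ⟨u₁, mem_vAA.2 ⟨hu₁, h1, h2⟩⟩
      obtain ⟨u₂, hu₂⟩ := hne
      obtain ⟨hu₂S, hu₂H, hπu₂H⟩ := mem_vAA.1 hu₂
      exact ⟨u₂, hu₂S, iff_of_true h1 hu₂H, iff_of_true h2 hπu₂H⟩
    · have hne : (vBH π S₂ H₂).Nonempty := by
        rw [← card_pos, ← hBH, card_pos]; exact ⟨u₁, mem_vBH.2 ⟨hu₁, h1, h2⟩⟩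
      obtain ⟨u₂, hu₂⟩ := hne
      obtain ⟨hu₂S, hu₂H, hπu₂H⟩ := mem_vBH.1 hu₂
      exact ⟨u₂, hu₂S, iff_of_true h1 hu₂H, iff_of_false h2 hπu₂H⟩
    · have hne : (vDD π S₂ H₂).Nonempty := by
        rw [← card_pos, ← hDD, card_pos]; exact ⟨u₁, mem_vDD.2 ⟨hu₁, h1, h2⟩⟩
      obtain ⟨u₂, hu₂⟩ := hne
      obtain ⟨hu₂S, hu₂H, hπu₂H⟩ := mem_vDD.1 hu₂
      exact ⟨u₂, hu₂S, iff_of_false h1 hu₂H, iff_of_false h2 hπu₂H⟩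
  -- the shifts agree
  have hsh1 : (({u₁} ∩ H₁ : Finset (Fin n)).card : ℕ) = (({u₂} ∩ H₂ : Finset (Fin n)).card : ℕ) := by
    by_cases h : u₁ ∈ H₁
    · rw [singleton_inter_of_mem h, singleton_inter_of_mem (hsame.1.1 h)]; rfl
    · rw [singleton_inter_of_notMem h, singleton_inter_of_notMem (fun h' => h (hsame.1.2 h'))]
  have hshπ : (({π u₁} ∩ H₁ : Finset (Fin n)).card : ℕ) = (({π u₂} ∩ H₂ : Finset (Fin n)).card : ℕ) := by
    by_cases h : π u₁ ∈ H₁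
    · rw [singleton_inter_of_mem h, singleton_inter_of_mem (hsame.2.1 h)]; rfl
    · rw [singleton_inter_of_notMem h, singleton_inter_of_notMem (fun h' => h (hsame.2.2 h'))]
  have hsh2 : (({u₁, π u₁} ∩ H₁ : Finset (Fin n)).card : ℕ) = (({u₂, π u₂} ∩ H₂ : Finset (Fin n)).card : ℕ) := by
    have e1 : ({u₁, π u₁} ∩ H₁ : Finset (Fin n)) = ({u₁} ∩ H₁) ∪ ({π u₁} ∩ H₁) := by
      rw [← union_inter_distrib_right]; rfl
    have e2 : ({u₂, π u₂} ∩ H₂ : Finset (Fin n)) = ({u₂} ∩ H₂) ∪ ({π u₂} ∩ H₂) := by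
      rw [← union_inter_distrib_right]; rfl
    have d1 : Disjoint ({u₁} ∩ H₁) ({π u₁} ∩ H₁) := disjoint_left.2 fun a ha ha' => by
      have h1 := mem_singleton.1 (mem_inter.1 ha).1; have h2 := mem_singleton.1 (mem_inter.1 ha').1
      exact hπ' u₁ (h2.symm.trans h1)
    have d2 : Disjoint ({u₂} ∩ H₂) ({π u₂} ∩ H₂) := disjoint_left.2 fun a ha ha' => by
      have h1 := mem_singleton.1 (mem_inter.1 ha).1; have h2 := mem_singleton.1 (mem_inter.1 ha').1
      exact hπ' u₂ (h2.symm.trans h1)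
    rw [e1, e2, card_union_of_disjoint d1, card_union_of_disjoint d2, hsh1, hshπ]
  -- the deleted configurations have matching type counts and fewer vertices
  have hP1 : ∀ v ∈ S₁ \ {u₁, π u₁}, π v ∈ S₁ \ {u₁, π u₁} := sdiff_pair_stable hπ hS₁ u₁
  have hP2 : ∀ v ∈ S₂ \ {u₂, π u₂}, π v ∈ S₂ \ {u₂, π u₂} := sdiff_pair_stable hπ hS₂ u₂
  have hlt : (S₁ \ {u₁, π u₁}).card < m := by
    have := card_sdiff_pair hπ' hS₁ hu₁; omega
  have hne1 : u₁ ≠ π u₁ := (hπ' u₁).symm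
  have hne2 : u₂ ≠ π u₂ := (hπ' u₂).symm
  have htypes : (vAA π (S₁ \ {u₁, π u₁}) H₁).card = (vAA π (S₂ \ {u₂, π u₂}) H₂).card ∧
      (vBH π (S₁ \ {u₁, π u₁}) H₁).card = (vBH π (S₂ \ {u₂, π u₂}) H₂).card ∧
      (vDD π (S₁ \ {u₁, π u₁}) H₁).card = (vDD π (S₂ \ {u₂, π u₂}) H₂).card := by
    rw [vAA_sdiff, vAA_sdiff, vBH_sdiff, vBH_sdiff, vDD_sdiff, vDD_sdiff]
    have cAA1 := card_sdiff_pair_cases (C := vAA π S₁ H₁) hne1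
    have cAA2 := card_sdiff_pair_cases (C := vAA π S₂ H₂) hne2
    have cBH1 := card_sdiff_pair_cases (C := vBH π S₁ H₁) hne1
    have cBH2 := card_sdiff_pair_cases (C := vBH π S₂ H₂) hne2
    have cDD1 := card_sdiff_pair_cases (C := vDD π S₁ H₁) hne1
    have cDD2 := card_sdiff_pair_cases (C := vDD π S₂ H₂) hne2
    have hπu₁ := hS₁ u₁ hu₁; have hπu₂ := hS₂ u₂ hu₂
    rcases hcls with ⟨h1, h2⟩ | ⟨h1, h2⟩ | ⟨h1, h2⟩
    · -- HH edge: AA loses two, BH and DD untouched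
      have g1 := hsame.1.1 h1; have g2 := hsame.2.1 h2
      have a1 := cAA1.1 (mem_vAA.2 ⟨hu₁, h1, h2⟩) (mem_vAA.2 ⟨hπu₁, h2, by rw [hπ]; exact h1⟩)
      have a2 := cAA2.1 (mem_vAA.2 ⟨hu₂, g1, g2⟩) (mem_vAA.2 ⟨hπu₂, g2, by rw [hπ]; exact g1⟩)
      rw [cBH1.2.1 (fun h => (mem_vBH.1 h).2.2 h2) (fun h => (mem_vBH.1 h).2.2 (by rw [hπ]; exact h1)),
        cBH2.2.1 (fun h => (mem_vBH.1 h).2.2 g2) (fun h => (mem_vBH.1 h).2.2 (by rw [hπ]; exact g1)),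
        cDD1.2.1 (fun h => (mem_vDD.1 h).2.1 h1) (fun h => (mem_vDD.1 h).2.1 h2),
        cDD2.2.1 (fun h => (mem_vDD.1 h).2.1 g1) (fun h => (mem_vDD.1 h).2.1 g2)]
      exact ⟨by omega, hBH, hDD⟩
    · -- mixed edge, `u` the H-end: BH loses `u`, AA and DD untouched
      have g1 := hsame.1.1 h1; have g2 : π u₂ ∉ H₂ := fun h => h2 (hsame.2.2 h)
      have b1 := cBH1.2.2 (mem_vBH.2 ⟨hu₁, h1, h2⟩) (fun h => h2 (mem_vBH.1 h).2.1)
      have b2 := cBH2.2.2 (mem_vBH.2 ⟨hu₂, g1, g2⟩) (fun h => g2 (mem_vBH.1 h).2.1)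
      rw [cAA1.2.1 (fun h => h2 (mem_vAA.1 h).2.2) (fun h => h2 (mem_vAA.1 h).2.1),
        cAA2.2.1 (fun h => g2 (mem_vAA.1 h).2.2) (fun h => g2 (mem_vAA.1 h).2.1),
        cDD1.2.1 (fun h => (mem_vDD.1 h).2.1 h1) (fun h => (mem_vDD.1 h).2.2 (by rw [hπ]; exact h1)),
        cDD2.2.1 (fun h => (mem_vDD.1 h).2.1 g1) (fun h => (mem_vDD.1 h).2.2 (by rw [hπ]; exact g1))]
      exact ⟨hAA, by omega, hDD⟩
    · -- H̄H̄ edge: DD loses two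
      have g1 : u₂ ∉ H₂ := fun h => h1 (hsame.1.2 h); have g2 : π u₂ ∉ H₂ := fun h => h2 (hsame.2.2 h)
      have d1 := cDD1.1 (mem_vDD.2 ⟨hu₁, h1, h2⟩) (mem_vDD.2 ⟨hπu₁, h2, by rw [hπ]; exact h1⟩)
      have d2 := cDD2.1 (mem_vDD.2 ⟨hu₂, g1, g2⟩) (mem_vDD.2 ⟨hπu₂, g2, by rw [hπ]; exact g1⟩)
      rw [cAA1.2.1 (fun h => h1 (mem_vAA.1 h).2.1) (fun h => h2 (mem_vAA.1 h).2.1),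
        cAA2.2.1 (fun h => g1 (mem_vAA.1 h).2.1) (fun h => g2 (mem_vAA.1 h).2.1),
        cBH1.2.1 (fun h => h1 (mem_vBH.1 h).2.1) (fun h => h2 (mem_vBH.1 h).2.1),
        cBH2.2.1 (fun h => g1 (mem_vBH.1 h).2.1) (fun h => g2 (mem_vBH.1 h).2.1)]
      exact ⟨hAA, hBH, by omega⟩
  have IH := fun T' C' x' => ih _ hlt rfl hP1 hP2 htypes.1 htypes.2.1 htypes.2.2 T' C' x'
  -- decompose both sides by the chosen edge
  unfold shellCount
  rw [card_filter_split_two (shellIn π S₁ T C) (fun U => (((U ∩ H₁).card : ℕ) : ℤ) = x) u₁ (π u₁),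
    card_filter_split_two (shellIn π S₂ T C) (fun U => (((U ∩ H₂).card : ℕ) : ℤ) = x) u₂ (π u₂)]
  -- piece by piece
  have eA : (((shellIn π S₁ T C).filter fun U => (((U ∩ H₁).card : ℕ) : ℤ) = x ∧ u₁ ∉ U ∧ π u₁ ∉ U).card : ℝ) =
      (((shellIn π S₂ T C).filter fun U => (((U ∩ H₂).card : ℕ) : ℤ) = x ∧ u₂ ∉ U ∧ π u₂ ∉ U).card : ℝ) := by
    rw [piece_avoid hπ hπ', piece_avoid hπ hπ']
    exact IH T C x
  have eF : (((shellIn π S₁ T C).filter fun U => (((U ∩ H₁).card : ℕ) : ℤ) = x ∧ u₁ ∈ U ∧ π u₁ ∈ U).card : ℝ) =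
      (((shellIn π S₂ T C).filter fun U => (((U ∩ H₂).card : ℕ) : ℤ) = x ∧ u₂ ∈ U ∧ π u₂ ∈ U).card : ℝ) := by
    rcases Nat.lt_or_ge T 2 with hT | hT
    · rw [piece_full_zero hπ' S₁ H₁ u₁ (by omega) x, piece_full_zero hπ' S₂ H₂ u₂ (by omega) x]
    · obtain ⟨T', rfl⟩ : ∃ T', T = T' + 2 := ⟨T - 2, by omega⟩
      rw [piece_full hπ hπ' hS₁ hu₁, piece_full hπ hπ' hS₂ hu₂, hsh2]
      exact IH T' C _
  have eHu : (((shellIn π S₁ T C).filter fun U => (((U ∩ H₁).card : ℕ) : ℤ) = x ∧ u₁ ∈ U ∧ π u₁ ∉ U).card : ℝ) =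
      (((shellIn π S₂ T C).filter fun U => (((U ∩ H₂).card : ℕ) : ℤ) = x ∧ u₂ ∈ U ∧ π u₂ ∉ U).card : ℝ) := by
    rcases Nat.eq_zero_or_pos T with hT | hT
    · rw [(piece_half_zero hπ' S₁ H₁ u₁ (Or.inl hT) x).1, (piece_half_zero hπ' S₂ H₂ u₂ (Or.inl hT) x).1]
    rcases Nat.eq_zero_or_pos C with hC | hC
    · rw [(piece_half_zero hπ' S₁ H₁ u₁ (Or.inr hC) x).1, (piece_half_zero hπ' S₂ H₂ u₂ (Or.inr hC) x).1]
    obtain ⟨T', rfl⟩ : ∃ T', T = T' + 1 := ⟨T - 1, by omega⟩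
    obtain ⟨C', rfl⟩ : ∃ C', C = C' + 1 := ⟨C - 1, by omega⟩
    rw [piece_half hπ hπ' hu₁, piece_half hπ hπ' hu₂, hsh1]
    exact IH T' C' _
  have eHπ : (((shellIn π S₁ T C).filter fun U => (((U ∩ H₁).card : ℕ) : ℤ) = x ∧ u₁ ∉ U ∧ π u₁ ∈ U).card : ℝ) =
      (((shellIn π S₂ T C).filter fun U => (((U ∩ H₂).card : ℕ) : ℤ) = x ∧ u₂ ∉ U ∧ π u₂ ∈ U).card : ℝ) := by
    rcases Nat.eq_zero_or_pos T with hT | hT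
    · have z1 := (piece_half_zero hπ' S₁ H₁ (π u₁) (C := C) (Or.inl hT) x).1
      have z2 := (piece_half_zero hπ' S₂ H₂ (π u₂) (C := C) (Or.inl hT) x).1
      rw [hπ] at z1 z2
      rw [show ((shellIn π S₁ T C).filter fun U => (((U ∩ H₁).card : ℕ) : ℤ) = x ∧ u₁ ∉ U ∧ π u₁ ∈ U) =
          ((shellIn π S₁ T C).filter fun U => (((U ∩ H₁).card : ℕ) : ℤ) = x ∧ π u₁ ∈ U ∧ u₁ ∉ U) from
          filter_congr fun U _ => by tauto, z1,
        show ((shellIn π S₂ T C).filter fun U => (((U ∩ H₂).card : ℕ) : ℤ) = x ∧ u₂ ∉ U ∧ π u₂ ∈ U) =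
          ((shellIn π S₂ T C).filter fun U => (((U ∩ H₂).card : ℕ) : ℤ) = x ∧ π u₂ ∈ U ∧ u₂ ∉ U) from
          filter_congr fun U _ => by tauto, z2]
    rcases Nat.eq_zero_or_pos C with hC | hC
    · have z1 := (piece_half_zero hπ' S₁ H₁ (π u₁) (T := T) (Or.inr hC) x).1
      have z2 := (piece_half_zero hπ' S₂ H₂ (π u₂) (T := T) (Or.inr hC) x).1
      rw [hπ] at z1 z2
      rw [show ((shellIn π S₁ T C).filter fun U => (((U ∩ H₁).card : ℕ) : ℤ) = x ∧ u₁ ∉ U ∧ π u₁ ∈ U) =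
          ((shellIn π S₁ T C).filter fun U => (((U ∩ H₁).card : ℕ) : ℤ) = x ∧ π u₁ ∈ U ∧ u₁ ∉ U) from
          filter_congr fun U _ => by tauto, z1,
        show ((shellIn π S₂ T C).filter fun U => (((U ∩ H₂).card : ℕ) : ℤ) = x ∧ u₂ ∉ U ∧ π u₂ ∈ U) =
          ((shellIn π S₂ T C).filter fun U => (((U ∩ H₂).card : ℕ) : ℤ) = x ∧ π u₂ ∈ U ∧ u₂ ∉ U) from
          filter_congr fun U _ => by tauto, z2]
    obtain ⟨T', rfl⟩ : ∃ T', T = T' + 1 := ⟨T - 1, by omega⟩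
    obtain ⟨C', rfl⟩ : ∃ C', C = C' + 1 := ⟨C - 1, by omega⟩
    rw [piece_half' hπ hπ' hS₁ hu₁, piece_half' hπ hπ' hS₂ hu₂, hshπ]
    exact IH T' C' _
  rw [eA, eF, eHu, eHπ]

end Transport

/-- **Type transport, convenience form** (`m := |S₁|` instantiated): two `π`-stable configurations with the same type counts
have the same shell counts. This is the step that turns `delStep`'s comparison of the two differently deleted ground sets
(`S ∖ e_{HH} ∖ e_{H̄H̄}` of type `(a−1,b,d−1)` versus `S ∖ e_B ∖ e_{B′}` of type `(a,b−2,d)`) into the same-ground-set type step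
`typeStep_shellCount`: realise both types on one doubly-deleted ground set and transport. [cite: Rothvoss2017, §2 (PDF pp. 5–6)] -/
theorem shellCount_eq_of_types_eq' (hπ : ∀ v, π (π v) = v) (hπ' : ∀ v, π v ≠ v) {S₁ S₂ H₁ H₂ : Finset (Fin n)}
    (hS₁ : ∀ v ∈ S₁, π v ∈ S₁) (hS₂ : ∀ v ∈ S₂, π v ∈ S₂)
    (hAA : (vAA π S₁ H₁).card = (vAA π S₂ H₂).card) (hBH : (vBH π S₁ H₁).card = (vBH π S₂ H₂).card)
    (hDD : (vDD π S₁ H₁).card = (vDD π S₂ H₂).card) (T C : ℕ) (x : ℤ) :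
    shellCount π S₁ H₁ T C x = shellCount π S₂ H₂ T C x :=
  shellCount_eq_of_types_eq hπ hπ' S₁.card rfl hS₁ hS₂ hAA hBH hDD T C x

end ShellStep

end Literature.Combinatorics.Optimization

end
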